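import Mathlib
import Literature.MathematicalPhysics.QuantumFieldTheory.Balaban1983to89.B4Sect5L2
import Literature.MathematicalPhysics.QuantumFieldTheory.Balaban1983to89.Beta.CoordCubePoincare

/-!
# B6 (2.76): `Q'_jG'_jQ'_j* ≥ 2γ₀` and `G'_j = (Δ^η + aQ*Q)^{−1}` on the WHOLE lattice `ηℤ^d` (scalar, `U = 1`) —
# a Fourier-free kernel proof with a mesh-independent constant

T. Bałaban, *Propagators and renormalization transformations for lattice gauge theories. II*, Commun. Math. Phys.
**96** (1984) 223–250 [Balaban1984PropagatorsII] (= B6 of the series), §2, p. 236, (2.74)–(2.77) (journal page = PDF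
page + 222; ×2 render `run/shared/lean/pub/pub-balaban/b2b-balaban-ref1/pages/1984-cmp96-propagators-rt-II/…-p014-x2.png`).
Unit b2b-balaban-pv23-g7 (surge node prover #23, gen 7, cell pub-balaban; journal claim B6-276-QGQ-LOWER-ZD = KERNEL
self-row under the LEMMAS.md yield clause, lineage pv23; GAPS row C-pv23g7-5; BETA/WALL.md v2.2 §9 row «B4 Sect. 5
Theorem» names this as the one item still owed on that row: *"the lower bound A ≥ γ₀I for Bałaban's U = 1 operators on
ℤ⁴ (B6 (2.75))"*).  Tree imports: `…B4Sect5L2` ([ACCEPTED] p185545; through it `…B4Sect5Exhaustion` p185355 and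
`…B4Sect5Proof`) for the inverse-operator machinery, `…Beta.CoordCubePoincare` (through it `…Beta.BlockPoincare`) for
the discrete Poincaré inequality on a coordinate cube; nothing landed is edited.

VALUE = kernel discharge of the hypothesis "A ≥ γ₀I" of the B4 Sect. 5 Theorem for the two whole-lattice operators of
B6 §2 in the scalar (`U = 1`) case — `A = Δ^η + aQ*Q` (so that `G'_j = A^{−1}` exists on `l²` of the whole fine
lattice, with the exponentially decaying kernel `limInv`) and `A = Q'_jG'_jQ'_j*` (the printed (2.76), so that
`(Q'_jG'_jQ'_j*)^{−1}` exists on `l²(ℤ^d)`) — with coercivity constants depending on `d` and `a` ONLY (not on the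
mesh `η = L^{−j}`, not on any volume).  NOT summit progress; no new analytic input beyond finite sums, the discrete
Poincaré inequality on a cube (tree) and the variational inequality `⟨u, T^{−1}u⟩ ≥ 2⟨u, f⟩ − ⟨f, Tf⟩`.

## What is printed (verbatim, p. 236)

*"… ≥ ⟨ω₁, Q'_jG'_jQ'_j*ω₁⟩ − O(1)e^{−δ₀M}‖ω₁‖², (2.74)
where we have used the Theorem of [3], G'_j denotes the operator (Δ^{L^{−j}} + a_jQ'_j*Q'_j)^{−1} on the whole
lattice L^{−j}Z^d. In [3] an explicit representation of this operator was found and from this representation we get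
the following Fourier representation of Q'_jG'_jQ'_j*:
(Q'_jG'_jQ'_j*)^(p′) = Σ_l |u_j(p′+l)|²Δ₀(p′)/Δ(p′+l) · (a_j Σ_l |u_j(p′+l)|²Δ₀(p′)/Δ(p′+l) + Δ₀(p′))^{−1}, (2.75)
p′ ∈ [−π, π]^d, l was described in (2.45) [3]. From this representation and the bounds (2.50), (2.51) of that paper
it follows that
Q'_jG'_jQ'_j* ≥ 2γ₀; (2.76)
γ₀ is a positive, absolute constant (a = 1). For M sufficiently large we obtain
⟨ω₁, Q'_jG'^ξ(□̃)Q'_j*ω₁⟩ ≥ γ₀‖ω₁‖². (2.77)"*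

## Dictionary (this file's reading; D-pv23g7.3)

(Q1) The fine lattice `L^{−j}ℤ^d` ↦ SITE coordinates `p ∈ ℤ^d` (`X d := Fin d → ℤ`) with mesh `η = 1/(n+1)`, `n : ℕ`
ARBITRARY (`n + 1 = L^j` in print; nothing here uses that the side is a power of `L`); the unit lattice ↦ the block
labels `y ∈ ℤ^d`; the unit block over `y` ↦ `B n y = {p : blk p = y}`, the cube of side `n + 1` (`blk p μ = p μ div
(n+1)`, floor division; `chart n y : (Fin d → Fin (n+1)) ≃ B n y`).
(Q2) `Δ^{L^{−j}}` ↦ the nearest-neighbour lattice Laplacian `η^{−2}Σ_μ(2 − S_μ − S_μ^{−1})` on the WHOLE lattice (site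
matrix `((n:ℝ)+1)²·lapKer`); `Q'_j` ↦ the block AVERAGE onto the unit lattice, `(Q'f)(y) = η^d Σ_{p ∈ B(y)} f(p)` (the
`j`-fold composite of `L`-block averages IS the `L^j`-block average); `Q'_j*` ↦ its adjoint for the `η^d`-weighted scalar
product on the fine lattice and the plain one on the unit lattice, `(Q'*ω)(p) = ω(blk p)`; hence `a_jQ'_j*Q'_j` has site
matrix `a·η^d·[blk p = blk q]` and `Δ^η + aQ*Q` has site matrix `AX n a` (`= Aker n a` as a B4 kernel on `ℤ^d × Fin 1`).
(Q3) "`G'_j` = the operator `(Δ^{L^{−j}} + a_jQ'_j*Q'_j)^{−1}` on the whole lattice" ↦ the inverse of the bounded,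
coercive operator `opA ℤ^d (Aker n a)` on `l²(ℤ^d)` (`B4Sect5L2.opAEquiv`), whose matrix is the B4 Sect. 5 kernel
`limInv ℤ^d (Aker n a)` (`gPrime_exists`); `Q'_jG'_jQ'_j*` ↦ the unit-lattice kernel
`kerQGQ n a y y' = η^d Σ_{p ∈ B(y)} Σ_{q ∈ B(y')} G'(p,q)` (the matrix of the composite `Q'∘G'∘Q'*` for the plain scalar
product on the unit lattice; `KerQGQ` = the same as a B4 kernel on `ℤ^d × Fin 1`).
(Q4) "`Q'_jG'_jQ'_j* ≥ 2γ₀`" ↦ `2γ₀·Σ_y ω(y)² ≤ Σ_y ω(y) Σ_{y'} (Q'G'Q'*)(y,y') ω(y')` for every finitely supported `ω`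
(`qGq_lower`; = B4's (5.6) coercivity clause, `finCoercive_KerQGQ`), equivalently `2γ₀‖f‖² ≤ ⟪(Q'G'Q'*)f, f⟫` for every
`f ∈ l²(ℤ^d)` (`qGq_l2_lower`, via `B4Sect5L2.inner_opA_self_ge`).  OUR `2γ₀ := gammaQ d a = 1/(36^d(4d + a))`.

## What is kernel-checked here (0 sorry; axioms propext / Classical.choice / Quot.sound only)

§1 lattice/blocks [folklore]: `X`, `e`, `side`, `blk`, `loc`, `locFin`, `chart` (+ `blk_chart`, `loc_chart`,
`chart_blk_locFin`, `chart_inj`, `chart_stepUp`), `B` (+ `mem_B`, `sum_B`, `card_cube`, `sum_B_const`, `B_disjoint`),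
`U` (the block with its lower neighbours), distance lemmas.  §2 the site matrix [folklore]: `lapDir`, `lapKer`, `sameBlk`,
**`AX`**, **`Aker`**, symmetry, `c0`, `abs_AX_le` (`|A(p,q)| ≤ c0·e^{−|p−q|}`, finite range), `decayOn_Aker`.  §3 the form
[folklore]: `ext`, `cvec`, `lapForm_eq` (summation by parts: `⟨f, Δ_dir f⟩ = Σ_P (f(P) − f(P−e_μ))²` over the one-sided
neighbourhood `Pset`), `blkForm_eq` (`⟨f, Q*Qf⟩ = η^d Σ_blocks (Σ_B f)²`), `block_lower` (per block: Dirichlet energy inside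
the block + `a·η^d(Σ_B f)² ≥ min(2,a)·η²·Σ_B f²`, from `Beta.CoordCubePoincare.poincare_coordCube` and
`Beta.BlockPoincare.sum_sq_eq_var_add`), `sum_blocks_dirichlet_le`, **`coercive_AX : min(2,a)·Σ f² ≤ ⟨f, (Δ^η + aQ*Q)f⟩`**
on finitely supported `f`, uniformly in the mesh.  §4 **`hyp56Z_Aker`: B4 (5.6) holds for `Δ^η + aQ*Q` on `Ω = ℤ^d`**
with `(γ₀, c₀, δ₀) = (min(2,a), c0 d n a, 1)`.  §5 `inner_inv_ge` [folklore]: for a symmetric positive isomorphism `T` of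
a real inner product space, `⟨u, T^{−1}u⟩ ≥ 2⟨u, f⟩ − ⟨f, Tf⟩`.  §6–§7 the block bump [folklore]: the parabolic profile
`g1 n t = (t+1)(n+1−t)η²` on `{0,…,n}` (face values `η`, `0 ≤ g1 ≤ 1`, one-step variation `≤ η`: `g1_step_abs`, mass
`Theta1 n = Σ_t g1 n t` with `1/6 ≤ η·Theta1 ≤ 1`: `Theta1_div_ge`/`Theta1_div_le`), the product bump `bump p = Π_μ g1(loc p μ)`,
the test vector `F = ω(blk ·)·bump` (`F_step_abs`: bond differences `≤ η(|ω(blk p)| + |ω(blk(p+e_μ))|)`, inside a block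
from the step bound and across a face from the face values) and the finite-sum computations `sum_B_bump` (mass `Theta1^d`
per block), `form_sum_le` (`⟨F, AF⟩ ≤ (4d·η^{−d} + a·η^{d}·Theta1^{2d})·Σω²` — the taper makes the Dirichlet energy of a
bump `O(η^{−d})`, NOT `O(η^{−d−1})` as for a block indicator), `green_sum`, `pair_sum`, `scalar_key` (the optimisation
of the variational parameter).  §8 **`kerQGQ`**, **`qGq_lower`** ((2.76), kernel form).  §9 **`gPrime_exists`** (`G'_j`
exists on `l²(ℤ^d)`, `‖G'_j‖ ≤ min(2,a)^{−1}`, matrix `= limInv`), `KerQGQ`, `kerQGQ_symm`, `dist_blk_le`,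
`gammaQ`/`cQ`/`deltaQ` (+ positivity), `abs_kerQGQ_le` (`|(Q'G'Q'*)(y,y')| ≤ cQ·e^{−deltaQ|y−y'|}`), `finCoercive_KerQGQ`,
**`hyp56Z_KerQGQ`: B4 (5.6) holds for `Q'G'Q'*` on `ℤ^d` with `(γ₀, c₀, δ₀) = (gammaQ, cQ, deltaQ)`**, **`qGq_l2_lower`**
((2.76) on `l²(ℤ^d)`), **`qGq_inverse`** (`(Q'G'Q'*)^{−1}` exists, `‖(Q'G'Q'*)^{−1}‖ ≤ 36^d(4d+a)`), `hyp56Z_KerQGQ_mono`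
(so `B4Sect5Exhaustion.sect5ThmSetOmega_holds` / `B4Sect5L2.sect5ThmL2_holds` apply to `A = Q'G'Q'*` on every
`Λ ⊆ ℤ^d`).

Proof route of (2.76) (NOT the printed one): with `T = Δ^η + aQ*Q` on `l²(ℤ^d)`, `u = Q'*ω` and the test vector
`f = λF`, `λ ∈ ℝ` (block bumps weighted by `ω`), `η^{−d}·⟨ω, Q'G'Q'*ω⟩ = ⟨u, T^{−1}u⟩ ≥ 2λ⟨u, F⟩ − λ²⟨F, TF⟩`; the
bump has mass `Theta1^d ≥ (6η)^{−d}` per block, `Q*Q`-energy `≤ a·η^{d}·Theta1^{2d}·ω(y)² ≤ a·η^{−d}ω(y)²` and — because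
it tapers to `η` at the block faces with steps `≤ η` — Dirichlet energy `≤ 4d·η^{−d}ω(y)²` (summed); the choice
`λ = 6^{−d}/(4d + a)` (`scalar_key`) gives `⟨ω, Q'G'Q'*ω⟩ ≥ gammaQ·Σω²`, `gammaQ = 1/(36^d(4d+a))`.

## Honest scope / what this does NOT do

* SCALAR, `U = 1` only: the operators of (2.75)/(2.76) are the free (`U = 1`) whole-lattice operators (a Fourier
  representation is asserted for them); componentwise extension to `ℝ^N`-valued fields is immediate but not typed; the
  covariant (`U ≠ 1`) operators `G'_j(□̃)`, `G'^ξ(□̃)` of (2.74)/(2.77), the comparison (2.74) (which uses the Theorem of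
  [3]) and the conclusions (2.77)/(2.78) are NOT touched.
* The CONSTANT is ours and is not the printed one: print has `2γ₀` with *"γ₀ a positive, absolute constant (a = 1)"*
  obtained from (2.75) and [3] (2.50), (2.51); ours is `gammaQ d a = 1/(36^d(4d+a))` — independent of the mesh and of
  any volume (the uniformity the consumers need), but depending on `d` and `a` and far from sharp.  For `Δ^η + aQ*Q` our
  `γ₀` is `min(2, a)`; no `Δ_a ≥ γ₀(Δ + I)`-type bound (B5 (1.83)) is claimed here — only `≥ min(2,a)·I`.
* The Fourier representation (2.75), the functions `u_j`, `Δ₀`, `Δ`, the index set of (2.45) [3] and the bounds (2.50),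
  (2.51) of [3] are NOT formalised; (2.76) is proved by a different (variational) argument, so this file certifies the
  printed STATEMENT (2.76) in the scalar case, not the printed derivation.
* The entry bound / decay rate of `Q'G'Q'*` (`cQ`, `deltaQ`) are inherited from B4 (5.7) for `G'_j` at mesh-DEPENDENT
  constants (`c0 d n a`, `deltaStar d 1 (min 2 a) (c0 d n a) 1`); no mesh-uniform decay of `G'_j` or of `Q'G'Q'*` (B6
  Prop. 2.5-type statements) is claimed.  `a > 0` is required throughout (print: `a_j > 0`).
* ABSOLUTE-RULE census: no statement of B6 (or of any manuscript) enters as a hypothesis; every theorem's hypotheses are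
  `0 < a` (and memberships in blocks); the non-Mathlib inputs are the sorry-free tree theorems
  `…B4Sect5Exhaustion.{limInv_abs_le, limInv_symm, Hyp56Z.mono}`, `…B4Sect5L2.{hyp56Z_coercive_of_finCoercive,
  inner_opA_self_ge, opAEquiv_apply, norm_inv_le, inv_apply_eq_tsum, G_eq_limInv}`, `…B4Sect5Proof.{cStar_pos,
  deltaStar_pos}`, `…Beta.CoordCubePoincare.poincare_coordCube`, `…Beta.BlockPoincare.sum_sq_eq_var_add` and the
  DEFINITIONS `…B4Sect5Exhaustion.{K, Hyp56Z, limInv}`, `…B4Sect5L2.{H, idx, kerA, FinCoercive, DecayOn, opA, opAEquiv}`,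
  `…B4Sect5Proof.{cStar, deltaStar}`, `…Beta.CoordCubePoincare.stepUp`, `…Beta.BlockPoincare.avg`.
-/

namespace Literature.MathematicalPhysics.QuantumFieldTheory.Balaban1983to89.B6QGQLower276

open Finset Real
open B4Sect5Exhaustion B4Sect5L2
open B4Sect5Proof (cStar deltaStar cStar_pos deltaStar_pos)
open Beta.CoordCubePoincare (stepUp poincare_coordCube)
open Beta.BlockPoincare (avg sum_sq_eq_var_add)

noncomputable section

variable {d : ℕ}

/-! ## §1  The fine lattice `ℤ^d`, blocks of side `n + 1`, block charts [folklore] -/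

/-- Sites of the fine lattice `L^{−j}ℤ^d`, in site (integer) coordinates. [folklore] -/
abbrev X (d : ℕ) : Type := Fin d → ℤ

/-- The unit vector `e_μ`. [folklore] -/
def e (μ : Fin d) : X d := Pi.single μ 1

/-- `e_μ(μ) = 1`. [folklore] -/
@[simp] theorem e_apply_self (μ : Fin d) : e μ μ = 1 := by simp [e]

/-- `e_μ(ν) = 0` for `ν ≠ μ`. [folklore] -/
theorem e_apply_ne {μ ν : Fin d} (h : ν ≠ μ) : e μ ν = 0 := by simp [e, h]

/-- `e_μ ≠ 0`. [folklore] -/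
theorem e_ne_zero (μ : Fin d) : e μ ≠ (0 : X d) := by
  intro h
  have := congrFun h μ
  simp at this

/-- `p ≠ p + e_μ`. [folklore] -/
theorem ne_add_e (p : X d) (μ : Fin d) : p ≠ p + e μ := by
  intro h
  exact e_ne_zero μ (by simpa using h.symm)

/-- `p ≠ p − e_μ`. [folklore] -/
theorem ne_sub_e (p : X d) (μ : Fin d) : p ≠ p - e μ := by
  intro h
  exact e_ne_zero μ (by
    have h' : p - (p - e μ) = 0 := by rw [← h]; simp
    simpa using h')

/-- The block side `n + 1` as an integer (`n + 1 = L^j` sites per unit block of the `L^{−j}`-lattice). [folklore] -/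
def side (n : ℕ) : ℤ := (n : ℤ) + 1

/-- The side is positive (and at least one). [folklore] -/
theorem side_facts (n : ℕ) : 0 < side n ∧ 1 ≤ side n := by unfold side; omega

/-- The block label of a site: componentwise floor division by the side (a point of the unit lattice `ℤ^d`).
[folklore] -/
def blk (n : ℕ) (p : X d) : X d := fun μ => p μ / side n

/-- The local coordinate of a site inside its block (componentwise remainder). [folklore] -/
def loc (n : ℕ) (p : X d) (μ : Fin d) : ℤ := p μ % side n

/-- `0 ≤ loc`. [folklore] -/
theorem loc_nonneg (n : ℕ) (p : X d) (μ : Fin d) : 0 ≤ loc n p μ :=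
  Int.emod_nonneg _ (side_facts n).1.ne'

/-- `loc < n + 1`. [folklore] -/
theorem loc_lt (n : ℕ) (p : X d) (μ : Fin d) : loc n p μ < side n :=
  Int.emod_lt_of_pos _ (side_facts n).1

/-- `loc ≤ n`. [folklore] -/
theorem loc_le (n : ℕ) (p : X d) (μ : Fin d) : loc n p μ ≤ n := by
  have := loc_lt n p μ; unfold side at this; omega

/-- Euclidean division: `(n+1)·blk + loc = p`, componentwise. [folklore] -/
theorem side_mul_blk_add_loc (n : ℕ) (p : X d) (μ : Fin d) : side n * blk n p μ + loc n p μ = p μ := by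
  have := Int.emod_def (p μ) (side n)
  unfold blk loc
  linarith

/-- The local coordinate as an element of `Fin (n+1)`. [folklore] -/
def locFin (n : ℕ) (p : X d) : Fin d → Fin (n + 1) := fun μ =>
  ⟨(loc n p μ).toNat, by have := loc_nonneg n p μ; have := loc_le n p μ; omega⟩

/-- The value of `locFin` is `loc`. [folklore] -/
theorem locFin_val (n : ℕ) (p : X d) (μ : Fin d) : (((locFin n p μ : Fin (n + 1)) : ℕ) : ℤ) = loc n p μ := by
  simp [locFin, Int.toNat_of_nonneg (loc_nonneg n p μ)]

/-- **The block chart**: the site of block `y` with local coordinates `z`. [folklore] -/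
def chart (n : ℕ) (y : X d) (z : Fin d → Fin (n + 1)) : X d := fun μ => side n * y μ + ((z μ : ℕ) : ℤ)

/-- A chart point lies in its block: `blk (chart y z) = y`. [folklore] -/
theorem blk_chart (n : ℕ) (y : X d) (z : Fin d → Fin (n + 1)) : blk n (chart n y z) = y := by
  funext μ
  have hz0 : (0 : ℤ) ≤ ((z μ : ℕ) : ℤ) := by positivity
  have hz1 : ((z μ : ℕ) : ℤ) < side n := by unfold side; have := (z μ).2; omega
  show (side n * y μ + ((z μ : ℕ) : ℤ)) / side n = y μ
  rw [show side n * y μ + ((z μ : ℕ) : ℤ) = ((z μ : ℕ) : ℤ) + side n * y μ from by ring,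
    Int.add_mul_ediv_left _ _ (side_facts n).1.ne', Int.ediv_eq_zero_of_lt hz0 hz1, zero_add]

/-- Local coordinates of a chart point: `loc (chart y z) = z`. [folklore] -/
theorem loc_chart (n : ℕ) (y : X d) (z : Fin d → Fin (n + 1)) (μ : Fin d) :
    loc n (chart n y z) μ = ((z μ : ℕ) : ℤ) := by
  have hz0 : (0 : ℤ) ≤ ((z μ : ℕ) : ℤ) := by positivity
  have hz1 : ((z μ : ℕ) : ℤ) < side n := by unfold side; have := (z μ).2; omega
  show (side n * y μ + ((z μ : ℕ) : ℤ)) % side n = ((z μ : ℕ) : ℤ)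
  rw [show side n * y μ + ((z μ : ℕ) : ℤ) = ((z μ : ℕ) : ℤ) + side n * y μ from by ring,
    Int.add_mul_emod_self_left, Int.emod_eq_of_lt hz0 hz1]

/-- `locFin (chart y z) = z`. [folklore] -/
theorem locFin_chart (n : ℕ) (y : X d) (z : Fin d → Fin (n + 1)) : locFin n (chart n y z) = z := by
  funext μ
  apply Fin.ext
  have h := locFin_val n (chart n y z) μ
  rw [loc_chart] at h
  exact_mod_cast h

/-- Every site is the chart point of its block at its local coordinates. [folklore] -/
theorem chart_blk_locFin (n : ℕ) (p : X d) : chart n (blk n p) (locFin n p) = p := by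
  funext μ
  show side n * blk n p μ + (((locFin n p μ : Fin (n + 1)) : ℕ) : ℤ) = p μ
  rw [locFin_val, side_mul_blk_add_loc]

/-- The chart is jointly injective in (block, local coordinates). [folklore] -/
theorem chart_inj {n : ℕ} {y y' : X d} {z z' : Fin d → Fin (n + 1)} (h : chart n y z = chart n y' z') :
    y = y' ∧ z = z' := by
  constructor
  · have := congrArg (blk n) h
    rwa [blk_chart, blk_chart] at this
  · have := congrArg (locFin n) h
    rwa [locFin_chart, locFin_chart] at this

/-- The step `z ↦ z + e_μ` inside the coordinate cube is the lattice step `+ e_μ` through the chart. [folklore] -/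
theorem chart_stepUp (n : ℕ) (y : X d) {z : Fin d → Fin (n + 1)} {μ : Fin d} (hz : z μ ≠ Fin.last n) :
    chart n y (stepUp z μ) = chart n y z + e μ := by
  funext ν
  simp only [chart, stepUp, Pi.add_apply, Function.update_apply]
  by_cases hν : ν = μ
  · subst hν
    have h1 : (((z ν + 1 : Fin (n + 1)) : ℕ) : ℤ) = ((z ν : ℕ) : ℤ) + 1 := by
      have := Fin.val_add_one_of_lt (Fin.lt_last_iff_ne_last.mpr hz)
      exact_mod_cast this
    rw [if_pos rfl, h1, e_apply_self]
    ring
  · rw [if_neg hν, e_apply_ne hν]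
    ring

/-- **The block** `B(y)` of the unit-lattice point `y`: the sites with block label `y` (a cube of side `n+1`),
realised as the image of the chart. [folklore] -/
def B (n : ℕ) (y : X d) : Finset (X d) := (Finset.univ : Finset (Fin d → Fin (n + 1))).image (chart n y)

/-- Membership in a block is having that block label. [folklore] -/
theorem mem_B {n : ℕ} {y p : X d} : p ∈ B n y ↔ blk n p = y := by
  constructor
  · intro hp
    obtain ⟨z, _, rfl⟩ := Finset.mem_image.1 hp
    exact blk_chart n y z
  · intro hp
    exact Finset.mem_image.2 ⟨locFin n p, Finset.mem_univ _, by rw [← hp, chart_blk_locFin]⟩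

/-- A chart point is in its block. [folklore] -/
theorem chart_mem_B (n : ℕ) (y : X d) (z : Fin d → Fin (n + 1)) : chart n y z ∈ B n y :=
  mem_B.2 (blk_chart n y z)

/-- Sums over a block are sums over the coordinate cube. [folklore] -/
theorem sum_B {n : ℕ} (y : X d) (f : X d → ℝ) :
    ∑ p ∈ B n y, f p = ∑ z : Fin d → Fin (n + 1), f (chart n y z) :=
  Finset.sum_image fun _ _ _ _ h => (chart_inj h).2

/-- The coordinate cube has `(n+1)^d` points. [folklore] -/
theorem card_cube (d n : ℕ) : (Fintype.card (Fin d → Fin (n + 1)) : ℝ) = ((n : ℝ) + 1) ^ d := by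
  simp

/-- `Σ_{p ∈ B(y)} 1 = (n+1)^d`. [folklore] -/
theorem sum_B_const {n : ℕ} (y : X d) (c : ℝ) : ∑ _p ∈ B n y, c = ((n : ℝ) + 1) ^ d * c := by
  rw [sum_B, Finset.sum_const, Finset.card_univ, nsmul_eq_mul, card_cube]

/-- Distinct blocks are disjoint. [folklore] -/
theorem B_disjoint {n : ℕ} {y y' : X d} (h : y ≠ y') : Disjoint (B n y) (B n y') :=
  Finset.disjoint_left.2 fun _ hp hp' => h ((mem_B.1 hp).symm.trans (mem_B.1 hp'))

/-- The union of the blocks labelled by a finite set `S` of unit-lattice points. [folklore] -/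
def U (n : ℕ) (S : Finset (X d)) : Finset (X d) := S.biUnion (B n)

/-- Membership in the union of blocks. [folklore] -/
theorem mem_U {n : ℕ} {S : Finset (X d)} {p : X d} : p ∈ U n S ↔ blk n p ∈ S := by
  constructor
  · intro hp
    obtain ⟨y, hy, hpy⟩ := Finset.mem_biUnion.1 hp
    rwa [← mem_B.1 hpy] at hy
  · intro hp
    exact Finset.mem_biUnion.2 ⟨blk n p, hp, mem_B.2 rfl⟩

/-- Sums over a union of blocks split block by block. [folklore] -/
theorem sum_U {n : ℕ} (S : Finset (X d)) (f : X d → ℝ) :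
    ∑ p ∈ U n S, f p = ∑ y ∈ S, ∑ p ∈ B n y, f p :=
  Finset.sum_biUnion fun _ _ _ _ h => B_disjoint h

/-- Two sites of the same block are at sup-distance `≤ n`. [folklore] -/
theorem dist_le_of_blk_eq {n : ℕ} {p q : X d} (h : blk n p = blk n q) : dist p q ≤ n := by
  refine (dist_pi_le_iff (by positivity)).2 fun μ => ?_
  rw [Int.dist_eq]
  have hp := side_mul_blk_add_loc n p μ
  have hq := side_mul_blk_add_loc n q μ
  have hμ : blk n p μ = blk n q μ := congrFun h μ
  have h1 := loc_nonneg n p μ; have h2 := loc_le n p μ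
  have h3 := loc_nonneg n q μ; have h4 := loc_le n q μ
  rw [hμ] at hp
  have : |p μ - q μ| ≤ (n : ℤ) := by
    rw [abs_le]; constructor <;> linarith
  have h' : |((p μ : ℤ) : ℝ) - ((q μ : ℤ) : ℝ)| ≤ (n : ℝ) := by exact_mod_cast this
  exact h'

/-- `dist p (p + e_μ) ≤ 1`. [folklore] -/
theorem dist_add_e_le (p : X d) (μ : Fin d) : dist p (p + e μ) ≤ 1 := by
  refine (dist_pi_le_iff zero_le_one).2 fun ν => ?_
  rw [Int.dist_eq, Pi.add_apply]
  by_cases hν : ν = μ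
  · subst hν; simp
  · simp [e_apply_ne hν]

/-- `dist p (p − e_μ) ≤ 1`. [folklore] -/
theorem dist_sub_e_le (p : X d) (μ : Fin d) : dist p (p - e μ) ≤ 1 := by
  refine (dist_pi_le_iff zero_le_one).2 fun ν => ?_
  rw [Int.dist_eq, Pi.sub_apply]
  by_cases hν : ν = μ
  · subst hν; simp
  · simp [e_apply_ne hν]

/-! ## §2  The site matrix of `Δ^η + aQ*Q` (`η = 1/(n+1)`) on the whole lattice [folklore] -/

/-- The second-difference kernel in direction `μ`: `2δ_{q,p} − δ_{q,p+e_μ} − δ_{q,p−e_μ}`. [folklore] -/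
def lapDir (μ : Fin d) (p q : X d) : ℝ :=
  (if q = p then 2 else 0) - (if q = p + e μ then 1 else 0) - (if q = p - e μ then 1 else 0)

/-- The (positive) lattice Laplacian kernel `−Δ = Σ_μ (2δ_{q,p} − δ_{q,p+e_μ} − δ_{q,p−e_μ})` in site units. [folklore] -/
def lapKer (p q : X d) : ℝ := ∑ μ, lapDir μ p q

/-- Indicator of "same block". [folklore] -/
def sameBlk (n : ℕ) (p q : X d) : ℝ := if blk n p = blk n q then 1 else 0

/-- **The site matrix of `Δ^η + aQ*Q`** on the `η = 1/(n+1)` lattice: `(n+1)²(−Δ_sites) + a(n+1)^{−d}·1[same block]`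
(`Δ^η = η^{−2}(−Δ_sites)`, `(Q*Qf)(p) = (n+1)^{−d} Σ_{q ∈ B(p)} f(q)`). [folklore] -/
def AX (n : ℕ) (a : ℝ) (p q : X d) : ℝ :=
  ((n : ℝ) + 1) ^ 2 * lapKer p q + a / ((n : ℝ) + 1) ^ d * sameBlk n p q

/-- The same matrix as a B4 kernel on the index set `K d 1 = ℤ^d × Fin 1` (scalar case `N = 1`). [folklore] -/
def Aker (n : ℕ) (a : ℝ) : K d 1 → K d 1 → ℝ := fun p q => AX n a p.1 q.1

/-- Symmetry of the directional second difference. [folklore] -/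
theorem lapDir_symm (μ : Fin d) (p q : X d) : lapDir μ p q = lapDir μ q p := by
  have A : (if p = q then (2 : ℝ) else 0) = (if q = p then 2 else 0) := by
    congr 1; exact propext eq_comm
  have B1 : (if p = q + e μ then (1 : ℝ) else 0) = (if q = p - e μ then 1 else 0) := by
    congr 1; exact propext ⟨fun h => by rw [h]; simp, fun h => by rw [h]; simp⟩
  have B2 : (if p = q - e μ then (1 : ℝ) else 0) = (if q = p + e μ then 1 else 0) := by
    congr 1; exact propext ⟨fun h => by rw [h]; simp, fun h => by rw [h]; simp⟩
  unfold lapDir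
  rw [A, B1, B2]
  ring

/-- Symmetry of the Laplacian kernel. [folklore] -/
theorem lapKer_symm (p q : X d) : lapKer p q = lapKer q p :=
  Finset.sum_congr rfl fun μ _ => lapDir_symm μ p q

/-- Symmetry of the block indicator. [folklore] -/
theorem sameBlk_symm (n : ℕ) (p q : X d) : sameBlk n p q = sameBlk n q p := by
  unfold sameBlk; congr 1; exact propext eq_comm

/-- Symmetry of the site matrix. [folklore] -/
theorem AX_symm (n : ℕ) (a : ℝ) (p q : X d) : AX n a p q = AX n a q p := by
  unfold AX; rw [lapKer_symm, sameBlk_symm]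

/-- The decay constant `c₀ = ((n+1)²·4d + |a|)·e^{n+1}` of the entry bound (mesh-dependent; only its existence matters).
[folklore] -/
def c0 (d n : ℕ) (a : ℝ) : ℝ := (((n : ℝ) + 1) ^ 2 * (4 * d) + |a|) * Real.exp ((n : ℝ) + 1)

/-- `c₀ > 0` as soon as `a ≠ 0`. [folklore] -/
theorem c0_pos (d n : ℕ) {a : ℝ} (ha : a ≠ 0) : 0 < c0 d n a := by
  unfold c0
  have : 0 < |a| := abs_pos.2 ha
  positivity

/-- An indicator supported where `dist p q ≤ n+1` is below `c·e^{n+1}·e^{−dist p q}`. [folklore] -/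
theorem ite_le_exp {P : Prop} [Decidable P] {c : ℝ} (hc : 0 ≤ c) {n : ℕ} {p q : X d}
    (h : P → dist p q ≤ (n : ℝ) + 1) :
    (if P then c else 0) ≤ c * Real.exp ((n : ℝ) + 1) * Real.exp (-(1 * dist p q)) := by
  split_ifs with hP
  · have hd := h hP
    have : 1 ≤ Real.exp ((n : ℝ) + 1) * Real.exp (-(1 * dist p q)) := by
      rw [← Real.exp_add]
      exact Real.one_le_exp (by linarith)
    nlinarith
  · positivity

/-- The entry bound `|A(p,q)| ≤ c₀e^{−|p−q|}` (finite range `≤ n+1`). [folklore] -/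
theorem abs_AX_le (n : ℕ) (a : ℝ) (p q : X d) : |AX n a p q| ≤ c0 d n a * Real.exp (-(1 * dist p q)) := by
  have hs1 : (1 : ℝ) ≤ (n : ℝ) + 1 := by have := Nat.cast_nonneg (α := ℝ) n; linarith
  have hn1 : (n : ℝ) ≤ (n : ℝ) + 1 := by linarith
  -- the Laplacian part, direction by direction
  have hdir : ∀ μ, |lapDir μ p q| ≤ 4 * Real.exp ((n : ℝ) + 1) * Real.exp (-(1 * dist p q)) := by
    intro μ
    have t1 := ite_le_exp (P := q = p) (c := (2 : ℝ)) (by norm_num) (n := n) (p := p) (q := q)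
      (fun h => by rw [h, dist_self]; positivity)
    have t2 := ite_le_exp (P := q = p + e μ) (c := (1 : ℝ)) (by norm_num) (n := n) (p := p) (q := q)
      (fun h => by rw [h]; exact (dist_add_e_le p μ).trans hs1)
    have t3 := ite_le_exp (P := q = p - e μ) (c := (1 : ℝ)) (by norm_num) (n := n) (p := p) (q := q)
      (fun h => by rw [h]; exact (dist_sub_e_le p μ).trans hs1)
    have n1 : 0 ≤ (if q = p then (2 : ℝ) else 0) := by split_ifs <;> norm_num
    have n2 : 0 ≤ (if q = p + e μ then (1 : ℝ) else 0) := by split_ifs <;> norm_num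
    have n3 : 0 ≤ (if q = p - e μ then (1 : ℝ) else 0) := by split_ifs <;> norm_num
    unfold lapDir
    rw [abs_le]
    constructor <;> nlinarith
  have hlap : |lapKer p q| ≤ (4 * d) * Real.exp ((n : ℝ) + 1) * Real.exp (-(1 * dist p q)) := by
    unfold lapKer
    refine (Finset.abs_sum_le_sum_abs _ _).trans ?_
    calc ∑ μ, |lapDir μ p q| ≤ ∑ _μ : Fin d, 4 * Real.exp ((n : ℝ) + 1) * Real.exp (-(1 * dist p q)) :=
          Finset.sum_le_sum fun μ _ => hdir μ
      _ = (4 * d) * Real.exp ((n : ℝ) + 1) * Real.exp (-(1 * dist p q)) := by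
          rw [Finset.sum_const, Finset.card_univ, Fintype.card_fin, nsmul_eq_mul]; ring
  have hblk : |sameBlk n p q| ≤ Real.exp ((n : ℝ) + 1) * Real.exp (-(1 * dist p q)) := by
    unfold sameBlk
    have := ite_le_exp (P := blk n p = blk n q) (c := (1 : ℝ)) (by norm_num) (n := n) (p := p) (q := q)
      (fun h => (dist_le_of_blk_eq h).trans hn1)
    rw [abs_of_nonneg (by split_ifs <;> norm_num)]
    simpa using this
  have hsd : a / ((n : ℝ) + 1) ^ d ≤ |a| := by
    rw [div_le_iff₀ (by positivity)]
    calc a ≤ |a| := le_abs_self a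
      _ = |a| * 1 := (mul_one _).symm
      _ ≤ |a| * ((n : ℝ) + 1) ^ d := mul_le_mul_of_nonneg_left (one_le_pow₀ hs1) (abs_nonneg a)
  have hsd' : |a / ((n : ℝ) + 1) ^ d| ≤ |a| := by
    rw [abs_div, abs_of_pos (by positivity : (0 : ℝ) < ((n : ℝ) + 1) ^ d), div_le_iff₀ (by positivity)]
    calc |a| = |a| * 1 := (mul_one _).symm
      _ ≤ |a| * ((n : ℝ) + 1) ^ d := mul_le_mul_of_nonneg_left (one_le_pow₀ hs1) (abs_nonneg a)
  unfold AX
  refine (abs_add_le _ _).trans ?_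
  rw [abs_mul, abs_mul, abs_of_nonneg (by positivity : (0 : ℝ) ≤ ((n : ℝ) + 1) ^ 2)]
  have E0 : 0 ≤ Real.exp ((n : ℝ) + 1) * Real.exp (-(1 * dist p q)) := by positivity
  calc ((n : ℝ) + 1) ^ 2 * |lapKer p q| + |a / ((n : ℝ) + 1) ^ d| * |sameBlk n p q|
      ≤ ((n : ℝ) + 1) ^ 2 * ((4 * d) * Real.exp ((n : ℝ) + 1) * Real.exp (-(1 * dist p q)))
        + |a| * (Real.exp ((n : ℝ) + 1) * Real.exp (-(1 * dist p q))) := by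
        refine add_le_add (mul_le_mul_of_nonneg_left hlap (by positivity)) ?_
        exact mul_le_mul hsd' hblk (abs_nonneg _) (abs_nonneg _)
    _ = c0 d n a * Real.exp (-(1 * dist p q)) := by unfold c0; ring

/-- The B4 entry bound (5.6) for the kernel `Aker` on `Ω = ℤ^d`, with `δ₀ = 1`. [folklore] -/
theorem decayOn_Aker (n : ℕ) (a : ℝ) : DecayOn (Set.univ : Set (Fin d → ℤ)) (Aker (d := d) n a) (c0 d n a) 1 :=
  fun p q _ _ => abs_AX_le n a p.1 q.1

/-! ## §3  The quadratic form of `A` on finitely supported vectors; `A ≥ min(2,a)·I` on the whole lattice [folklore] -/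

/-- Zero extension of a vector given on a finite set. [folklore] -/
def ext (S : Finset (X d)) (w : X d → ℝ) : X d → ℝ := fun p => if p ∈ S then w p else 0

/-- On the set, the extension is the vector. [folklore] -/
theorem ext_of_mem {S : Finset (X d)} {w : X d → ℝ} {p : X d} (hp : p ∈ S) : ext S w p = w p := by
  simp [ext, hp]

/-- Off the set, the extension vanishes. [folklore] -/
theorem ext_of_not_mem {S : Finset (X d)} {w : X d → ℝ} {p : X d} (hp : p ∉ S) : ext S w p = 0 := by
  simp [ext, hp]

/-- The bond vector `c_r = δ_r − δ_{r+e_μ}` evaluated at `p`. [folklore] -/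
def cvec (μ : Fin d) (r p : X d) : ℝ := (if p = r then 1 else 0) - (if p = r + e μ then 1 else 0)

/-- Pairing a finitely supported vector with a bond vector gives the bond difference of its extension. [folklore] -/
theorem sum_mul_cvec (S : Finset (X d)) (w : X d → ℝ) (μ : Fin d) (r : X d) :
    ∑ p ∈ S, w p * cvec μ r p = ext S w r - ext S w (r + e μ) := by
  simp only [cvec, mul_sub, Finset.sum_sub_distrib, mul_ite, mul_one, mul_zero]
  rw [Finset.sum_ite_eq' S r, Finset.sum_ite_eq' S (r + e μ)]
  rfl

/-- **Bond decomposition** of the directional second difference: for `p ∈ S` and any window `P ⊇ S ∪ (S − e_μ)`,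
`(2δ_{q,p} − δ_{q,p+e_μ} − δ_{q,p−e_μ}) = Σ_{r∈P} c_r(p)c_r(q)`. [folklore] -/
theorem lapDir_eq_sum_cvec (S P : Finset (X d)) (μ : Fin d) (hSP : S ⊆ P) (hSP' : ∀ p ∈ S, p - e μ ∈ P)
    {p : X d} (hp : p ∈ S) (q : X d) :
    lapDir μ p q = ∑ r ∈ P, cvec μ r p * cvec μ r q := by
  rw [Finset.sum_eq_add (p) (p - e μ) (ne_sub_e p μ)]
  · have h1 : cvec μ p p = 1 := by
      rw [cvec, if_pos rfl, if_neg (ne_add_e p μ)]; norm_num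
    have h2 : cvec μ (p - e μ) p = -1 := by
      rw [cvec, sub_add_cancel, if_neg (ne_sub_e p μ), if_pos rfl]; norm_num
    have h3 : cvec μ (p - e μ) q = (if q = p - e μ then 1 else 0) - (if q = p then 1 else 0) := by
      rw [cvec, sub_add_cancel]
    have h4 : (if q = p then (2 : ℝ) else 0) = 2 * (if q = p then 1 else 0) := by split_ifs <;> norm_num
    rw [h1, h2, h3]
    unfold lapDir cvec
    rw [h4]
    ring
  · intro r _ hr
    have h1 : ¬ (p = r) := fun h => hr.1 h.symm
    have h2 : ¬ (p = r + e μ) := fun h => hr.2 (by rw [h]; simp)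
    simp only [cvec, if_neg h1, if_neg h2, sub_self, zero_mul]
  · intro h; exact absurd (hSP hp) h
  · intro h; exact absurd (hSP' p hp) h

/-- **The Laplacian form is a sum of squared bond differences**: for a finitely supported `w` (support `S`) and any
window `P ⊇ S ∪ ⋃_μ (S − e_μ)`, `Σ_{p,q∈S} w_p(−Δ)_{pq}w_q = Σ_μ Σ_{r∈P} (w̄(r) − w̄(r+e_μ))²`, `w̄` the zero extension.
[folklore] -/
theorem lapForm_eq (S P : Finset (X d)) (hSP : S ⊆ P) (hSP' : ∀ μ, ∀ p ∈ S, p - e μ ∈ P) (w : X d → ℝ) :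
    ∑ p ∈ S, w p * ∑ q ∈ S, lapKer p q * w q
      = ∑ μ, ∑ r ∈ P, (ext S w r - ext S w (r + e μ)) ^ 2 := by
  calc ∑ p ∈ S, w p * ∑ q ∈ S, lapKer p q * w q
      = ∑ p ∈ S, ∑ q ∈ S, ∑ μ, w p * w q * lapDir μ p q := by
        refine Finset.sum_congr rfl fun p _ => ?_
        rw [Finset.mul_sum]
        refine Finset.sum_congr rfl fun q _ => ?_
        unfold lapKer
        rw [Finset.sum_mul, Finset.mul_sum]
        exact Finset.sum_congr rfl fun μ _ => by ring
    _ = ∑ p ∈ S, ∑ μ, ∑ q ∈ S, w p * w q * lapDir μ p q :=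
        Finset.sum_congr rfl fun p _ => Finset.sum_comm
    _ = ∑ μ, ∑ p ∈ S, ∑ q ∈ S, w p * w q * lapDir μ p q := Finset.sum_comm
    _ = ∑ μ, ∑ r ∈ P, (ext S w r - ext S w (r + e μ)) ^ 2 := by
        refine Finset.sum_congr rfl fun μ _ => ?_
        calc ∑ p ∈ S, ∑ q ∈ S, w p * w q * lapDir μ p q
            = ∑ p ∈ S, ∑ q ∈ S, ∑ r ∈ P, (w p * cvec μ r p) * (w q * cvec μ r q) := by
              refine Finset.sum_congr rfl fun p hp => Finset.sum_congr rfl fun q _ => ?_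
              rw [lapDir_eq_sum_cvec S P μ hSP (hSP' μ) hp q, Finset.mul_sum]
              exact Finset.sum_congr rfl fun r _ => by ring
          _ = ∑ p ∈ S, ∑ r ∈ P, ∑ q ∈ S, (w p * cvec μ r p) * (w q * cvec μ r q) :=
              Finset.sum_congr rfl fun p _ => Finset.sum_comm
          _ = ∑ r ∈ P, ∑ p ∈ S, ∑ q ∈ S, (w p * cvec μ r p) * (w q * cvec μ r q) := Finset.sum_comm
          _ = ∑ r ∈ P, (∑ p ∈ S, w p * cvec μ r p) * (∑ q ∈ S, w q * cvec μ r q) := by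
              refine Finset.sum_congr rfl fun r _ => ?_
              rw [Finset.sum_mul_sum]
          _ = ∑ r ∈ P, (ext S w r - ext S w (r + e μ)) ^ 2 := by
              refine Finset.sum_congr rfl fun r _ => ?_
              rw [sum_mul_cvec, sq]

/-- **The block form is a sum of squared block sums**: `Σ_{p,q∈S} w_p 1[blk p = blk q] w_q = Σ_y (Σ_{q∈S, blk q = y} w_q)²`.
[folklore] -/
theorem blkForm_eq (n : ℕ) (S : Finset (X d)) (w : X d → ℝ) :
    ∑ p ∈ S, w p * ∑ q ∈ S, sameBlk n p q * w q
      = ∑ y ∈ S.image (blk n), (∑ q ∈ S with blk n q = y, w q) ^ 2 := by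
  have hinner : ∀ p ∈ S, ∑ q ∈ S, sameBlk n p q * w q = ∑ q ∈ S with blk n q = blk n p, w q := by
    intro p _
    rw [Finset.sum_filter]
    refine Finset.sum_congr rfl fun q _ => ?_
    unfold sameBlk
    by_cases h : blk n q = blk n p
    · rw [if_pos h.symm, if_pos h, one_mul]
    · rw [if_neg (fun h' => h h'.symm), if_neg h, zero_mul]
  calc ∑ p ∈ S, w p * ∑ q ∈ S, sameBlk n p q * w q
      = ∑ y ∈ S.image (blk n), ∑ p ∈ S with blk n p = y, w p * ∑ q ∈ S, sameBlk n p q * w q :=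
        (Finset.sum_fiberwise_of_maps_to (fun p hp => Finset.mem_image_of_mem (blk n) hp) _).symm
    _ = ∑ y ∈ S.image (blk n), (∑ q ∈ S with blk n q = y, w q) ^ 2 := by
        refine Finset.sum_congr rfl fun y _ => ?_
        rw [sq, Finset.sum_mul]
        refine Finset.sum_congr rfl fun p hp => ?_
        rw [Finset.mem_filter] at hp
        rw [hinner p hp.1, hp.2]

/-- **Per-block Poincaré + mean**: on one block, `min(2,a)·Σ g² ≤ (n+1)²·(internal Dirichlet form) + a(n+1)^{−d}(Σ g)²`
(`CoordCubePoincare.poincare_coordCube` with constant `n(n+1)/2 ≤ (n+1)²`, and `Σ g² = Σ (g − ḡ)² + |B| ḡ²`).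
[folklore] -/
theorem block_lower (n : ℕ) (a : ℝ) (g : (Fin d → Fin (n + 1)) → ℝ) :
    min 2 a * ∑ z, g z ^ 2
      ≤ ((n : ℝ) + 1) ^ 2 * ∑ μ : Fin d, ∑ z ∈ univ.filter (fun z : Fin d → Fin (n + 1) => z μ ≠ Fin.last n),
          (g (stepUp z μ) - g z) ^ 2
        + a / ((n : ℝ) + 1) ^ d * (∑ z, g z) ^ 2 := by
  have hP := poincare_coordCube n d g
  have hsq := sum_sq_eq_var_add (Finset.univ : Finset (Fin d → Fin (n + 1))) g
  have hcard : ((Finset.univ : Finset (Fin d → Fin (n + 1))).card : ℝ) = ((n : ℝ) + 1) ^ d := by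
    rw [Finset.card_univ]; exact card_cube d n
  have havg : avg univ g = (∑ z, g z) / ((n : ℝ) + 1) ^ d := by unfold avg; rw [hcard]
  have hs : 0 < ((n : ℝ) + 1) ^ d := by positivity
  have hD : 0 ≤ ∑ μ : Fin d, ∑ z ∈ univ.filter (fun z : Fin d → Fin (n + 1) => z μ ≠ Fin.last n),
      (g (stepUp z μ) - g z) ^ 2 := Finset.sum_nonneg fun _ _ => Finset.sum_nonneg fun _ _ => sq_nonneg _
  have hV : 0 ≤ ∑ z, (g z - avg univ g) ^ 2 := Finset.sum_nonneg fun _ _ => sq_nonneg _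
  have hM : ((Finset.univ : Finset (Fin d → Fin (n + 1))).card : ℝ) * avg univ g ^ 2
      = (∑ z, g z) ^ 2 / ((n : ℝ) + 1) ^ d := by
    rw [hcard, havg]; field_simp
  rw [hsq, hM]
  have hmin2 : min 2 a ≤ 2 := min_le_left _ _
  have hmina : min 2 a ≤ a := min_le_right _ _
  have hn0 : (0 : ℝ) ≤ n := Nat.cast_nonneg n
  have hsq0 : 0 ≤ (∑ z, g z) ^ 2 / ((n : ℝ) + 1) ^ d := by positivity
  have h2P := mul_le_mul_of_nonneg_left hP (by norm_num : (0 : ℝ) ≤ 2)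
  have hnn : 2 * ((n : ℝ) * (n + 1) / 2) ≤ ((n : ℝ) + 1) ^ 2 := by nlinarith
  have h3 := mul_le_mul_of_nonneg_right hnn hD
  have e1 : a * ((∑ z, g z) ^ 2 / ((n : ℝ) + 1) ^ d) = a / ((n : ℝ) + 1) ^ d * (∑ z, g z) ^ 2 := by ring
  calc min 2 a * (∑ z, (g z - avg univ g) ^ 2 + (∑ z, g z) ^ 2 / ((n : ℝ) + 1) ^ d)
      = min 2 a * ∑ z, (g z - avg univ g) ^ 2 + min 2 a * ((∑ z, g z) ^ 2 / ((n : ℝ) + 1) ^ d) := by ring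
    _ ≤ 2 * ∑ z, (g z - avg univ g) ^ 2 + a * ((∑ z, g z) ^ 2 / ((n : ℝ) + 1) ^ d) :=
        add_le_add (mul_le_mul_of_nonneg_right hmin2 hV) (mul_le_mul_of_nonneg_right hmina hsq0)
    _ ≤ ((n : ℝ) + 1) ^ 2 * ∑ μ : Fin d, ∑ z ∈ univ.filter (fun z : Fin d → Fin (n + 1) => z μ ≠ Fin.last n),
          (g (stepUp z μ) - g z) ^ 2 + a / ((n : ℝ) + 1) ^ d * (∑ z, g z) ^ 2 := by
        nlinarith

/-- The bond window of a finite union of blocks: the union and its translates by `−e_μ`. [folklore] -/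
def Pset (n : ℕ) (Y : Finset (X d)) : Finset (X d) :=
  U n Y ∪ Finset.univ.biUnion (fun μ : Fin d => (U n Y).image (fun p => p - e μ))

/-- The union of blocks lies in its window. [folklore] -/
theorem U_subset_Pset (n : ℕ) (Y : Finset (X d)) : U n Y ⊆ Pset n Y := Finset.subset_union_left

/-- Translates by `−e_μ` of the union of blocks lie in the window. [folklore] -/
theorem sub_e_mem_Pset {n : ℕ} {Y : Finset (X d)} (μ : Fin d) {p : X d} (hp : p ∈ U n Y) : p - e μ ∈ Pset n Y :=
  Finset.mem_union_right _ (Finset.mem_biUnion.2 ⟨μ, Finset.mem_univ _, Finset.mem_image_of_mem _ hp⟩)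

/-- A set lies in the union of the blocks it meets. [folklore] -/
theorem subset_U_image (n : ℕ) (S : Finset (X d)) : S ⊆ U n (S.image (blk n)) :=
  fun _ hp => mem_U.2 (Finset.mem_image_of_mem _ hp)

/-- The form of `A` splits into the Laplacian form and the block form. [folklore] -/
theorem form_AX_split (n : ℕ) (a : ℝ) (S : Finset (X d)) (w : X d → ℝ) :
    ∑ p ∈ S, w p * ∑ q ∈ S, AX n a p q * w q
      = ((n : ℝ) + 1) ^ 2 * (∑ p ∈ S, w p * ∑ q ∈ S, lapKer p q * w q)
        + a / ((n : ℝ) + 1) ^ d * (∑ p ∈ S, w p * ∑ q ∈ S, sameBlk n p q * w q) := by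
  simp only [AX, add_mul, Finset.sum_add_distrib, mul_add, Finset.mul_sum]
  congr 1 <;> exact Finset.sum_congr rfl fun p _ => Finset.sum_congr rfl fun q _ => by ring

/-- The block-internal bonds of the blocks `Y`, read through the charts, are among the window's bonds. [folklore] -/
theorem sum_blocks_dirichlet_le (n : ℕ) (Y : Finset (X d)) (W : X d → ℝ) (μ : Fin d) :
    ∑ y ∈ Y, ∑ z ∈ univ.filter (fun z : Fin d → Fin (n + 1) => z μ ≠ Fin.last n),
        (W (chart n y (stepUp z μ)) - W (chart n y z)) ^ 2
      ≤ ∑ r ∈ Pset n Y, (W r - W (r + e μ)) ^ 2 := by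
  classical
  have hinj : Set.InjOn (fun x : X d × (Fin d → Fin (n + 1)) => chart n x.1 x.2)
      ↑(Y ×ˢ (univ.filter (fun z : Fin d → Fin (n + 1) => z μ ≠ Fin.last n))) := by
    intro x _ x' _ h
    have := chart_inj h
    exact Prod.ext this.1 this.2
  calc ∑ y ∈ Y, ∑ z ∈ univ.filter (fun z : Fin d → Fin (n + 1) => z μ ≠ Fin.last n),
          (W (chart n y (stepUp z μ)) - W (chart n y z)) ^ 2
      = ∑ x ∈ Y ×ˢ (univ.filter (fun z : Fin d → Fin (n + 1) => z μ ≠ Fin.last n)),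
          (W (chart n x.1 x.2 + e μ) - W (chart n x.1 x.2)) ^ 2 := by
        rw [Finset.sum_product]
        refine Finset.sum_congr rfl fun y _ => Finset.sum_congr rfl fun z hz => ?_
        rw [Finset.mem_filter] at hz
        rw [chart_stepUp n y hz.2]
    _ = ∑ r ∈ (Y ×ˢ (univ.filter (fun z : Fin d → Fin (n + 1) => z μ ≠ Fin.last n))).image
          (fun x => chart n x.1 x.2), (W (r + e μ) - W r) ^ 2 := by
        rw [Finset.sum_image hinj]
    _ ≤ ∑ r ∈ Pset n Y, (W (r + e μ) - W r) ^ 2 := by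
        refine Finset.sum_le_sum_of_subset_of_nonneg ?_ fun r _ _ => sq_nonneg _
        intro r hr
        obtain ⟨x, hx, rfl⟩ := Finset.mem_image.1 hr
        rw [Finset.mem_product] at hx
        exact U_subset_Pset n Y (Finset.mem_biUnion.2 ⟨x.1, hx.1, chart_mem_B n x.1 x.2⟩)
    _ = ∑ r ∈ Pset n Y, (W r - W (r + e μ)) ^ 2 := Finset.sum_congr rfl fun r _ => by ring

/-- The block sum of the zero extension is the sum over the part of the support in the block. [folklore] -/
theorem sum_filter_blk_eq (n : ℕ) (S : Finset (X d)) (w : X d → ℝ) (y : X d) :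
    ∑ q ∈ S with blk n q = y, w q = ∑ z : Fin d → Fin (n + 1), ext S w (chart n y z) := by
  classical
  rw [← sum_B y (ext S w)]
  have h1 : ∑ p ∈ B n y, ext S w p = ∑ p ∈ (B n y).filter (· ∈ S), w p := by
    rw [Finset.sum_filter]
    exact Finset.sum_congr rfl fun p _ => by simp [ext]
  rw [h1]
  refine Finset.sum_congr ?_ fun _ _ => rfl
  ext q
  simp only [Finset.mem_filter, mem_B]
  tauto

/-- **COERCIVITY OF `Δ^η + aQ*Q` ON THE WHOLE LATTICE**, uniformly in the mesh: for every finitely supported `w`,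
`min(2,a)·Σ w² ≤ ⟨w, A w⟩`.  (Block-internal bonds only; per block `CoordCubePoincare.poincare_coordCube`.) [folklore] -/
theorem coercive_AX (n : ℕ) (a : ℝ) (S : Finset (X d)) (w : X d → ℝ) :
    min 2 a * ∑ p ∈ S, w p ^ 2 ≤ ∑ p ∈ S, w p * ∑ q ∈ S, AX n a p q * w q := by
  classical
  have hSU := subset_U_image n S
  have hSP : S ⊆ Pset n (S.image (blk n)) := hSU.trans (U_subset_Pset n _)
  have hSP' : ∀ μ, ∀ p ∈ S, p - e μ ∈ Pset n (S.image (blk n)) := fun μ p hp => sub_e_mem_Pset μ (hSU hp)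
  rw [form_AX_split, lapForm_eq S _ hSP hSP' w, blkForm_eq n S w]
  -- the left side, block by block
  have hL : ∑ p ∈ S, w p ^ 2
      = ∑ y ∈ S.image (blk n), ∑ z : Fin d → Fin (n + 1), ext S w (chart n y z) ^ 2 := by
    calc ∑ p ∈ S, w p ^ 2 = ∑ p ∈ S, ext S w p ^ 2 :=
          Finset.sum_congr rfl fun p hp => by rw [ext_of_mem hp]
      _ = ∑ p ∈ U n (S.image (blk n)), ext S w p ^ 2 :=
          Finset.sum_subset hSU fun p _ hp => by rw [ext_of_not_mem hp]; ring
      _ = ∑ y ∈ S.image (blk n), ∑ p ∈ B n y, ext S w p ^ 2 := sum_U _ _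
      _ = ∑ y ∈ S.image (blk n), ∑ z : Fin d → Fin (n + 1), ext S w (chart n y z) ^ 2 :=
          Finset.sum_congr rfl fun y _ => sum_B y _
  have hblock : ∀ y ∈ S.image (blk n),
      min 2 a * ∑ z : Fin d → Fin (n + 1), ext S w (chart n y z) ^ 2
        ≤ ((n : ℝ) + 1) ^ 2 * ∑ μ : Fin d, ∑ z ∈ univ.filter (fun z : Fin d → Fin (n + 1) => z μ ≠ Fin.last n),
              (ext S w (chart n y (stepUp z μ)) - ext S w (chart n y z)) ^ 2
          + a / ((n : ℝ) + 1) ^ d * (∑ z : Fin d → Fin (n + 1), ext S w (chart n y z)) ^ 2 :=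
    fun y _ => block_lower n a (fun z => ext S w (chart n y z))
  have hswap : ∑ y ∈ S.image (blk n), ∑ μ : Fin d,
        ∑ z ∈ univ.filter (fun z : Fin d → Fin (n + 1) => z μ ≠ Fin.last n),
          (ext S w (chart n y (stepUp z μ)) - ext S w (chart n y z)) ^ 2
      = ∑ μ : Fin d, ∑ y ∈ S.image (blk n),
        ∑ z ∈ univ.filter (fun z : Fin d → Fin (n + 1) => z μ ≠ Fin.last n),
          (ext S w (chart n y (stepUp z μ)) - ext S w (chart n y z)) ^ 2 := Finset.sum_comm
  calc min 2 a * ∑ p ∈ S, w p ^ 2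
      = ∑ y ∈ S.image (blk n), min 2 a * ∑ z : Fin d → Fin (n + 1), ext S w (chart n y z) ^ 2 := by
        rw [hL, Finset.mul_sum]
    _ ≤ ∑ y ∈ S.image (blk n),
          (((n : ℝ) + 1) ^ 2 * ∑ μ : Fin d, ∑ z ∈ univ.filter (fun z : Fin d → Fin (n + 1) => z μ ≠ Fin.last n),
              (ext S w (chart n y (stepUp z μ)) - ext S w (chart n y z)) ^ 2
            + a / ((n : ℝ) + 1) ^ d * (∑ z : Fin d → Fin (n + 1), ext S w (chart n y z)) ^ 2) :=
        Finset.sum_le_sum hblock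
    _ = ((n : ℝ) + 1) ^ 2 * ∑ μ : Fin d, ∑ y ∈ S.image (blk n),
            ∑ z ∈ univ.filter (fun z : Fin d → Fin (n + 1) => z μ ≠ Fin.last n),
              (ext S w (chart n y (stepUp z μ)) - ext S w (chart n y z)) ^ 2
          + a / ((n : ℝ) + 1) ^ d
            * ∑ y ∈ S.image (blk n), (∑ z : Fin d → Fin (n + 1), ext S w (chart n y z)) ^ 2 := by
        rw [Finset.sum_add_distrib, ← Finset.mul_sum, ← Finset.mul_sum, hswap]
    _ ≤ ((n : ℝ) + 1) ^ 2 * ∑ μ : Fin d, ∑ r ∈ Pset n (S.image (blk n)), (ext S w r - ext S w (r + e μ)) ^ 2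
          + a / ((n : ℝ) + 1) ^ d * ∑ y ∈ S.image (blk n), (∑ q ∈ S with blk n q = y, w q) ^ 2 := by
        refine add_le_add (mul_le_mul_of_nonneg_left
          (Finset.sum_le_sum fun μ _ => sum_blocks_dirichlet_le n _ (ext S w) μ) (by positivity)) (le_of_eq ?_)
        congr 1
        exact Finset.sum_congr rfl fun y _ => by rw [sum_filter_blk_eq n S w y]

/-! ## §4  Condition (5.6) of B4 for `Δ^η + aQ*Q` on `Ω = ℤ^d` (hence `G'_j` exists on `l²(ℤ^d)`) [folklore] -/

/-- The index type of `l²(ℤ^d)` (B4Sect5L2, `N = 1`) projects to the sites. [folklore] -/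
def toX (i : idx 1 (Set.univ : Set (Fin d → ℤ))) : X d := i.1.1

/-- The site as an index of `l²(ℤ^d)`. [folklore] -/
def ofX (x : X d) : idx 1 (Set.univ : Set (Fin d → ℤ)) := ⟨(x, 0), mem_KSet.mpr (Set.mem_univ _)⟩

/-- `toX ∘ ofX = id`. [folklore] -/
@[simp] theorem toX_ofX (x : X d) : toX (ofX x) = x := rfl

/-- `ofX ∘ toX = id` (the `Fin 1` component is trivial). [folklore] -/
@[simp] theorem ofX_toX (i : idx 1 (Set.univ : Set (Fin d → ℤ))) : ofX (toX i) = i := by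
  apply Subtype.ext
  apply Prod.ext
  · rfl
  · exact Subsingleton.elim _ _

/-- `toX` is injective. [folklore] -/
theorem toX_injective : Function.Injective (toX (d := d)) := fun i j h => by
  rw [← ofX_toX i, ← ofX_toX j, h]

/-- `toX` as an embedding. [folklore] -/
def embX : idx 1 (Set.univ : Set (Fin d → ℤ)) ↪ X d := ⟨toX, toX_injective⟩

/-- Values of the embedding. [folklore] -/
@[simp] theorem embX_apply (i : idx 1 (Set.univ : Set (Fin d → ℤ))) : embX i = toX i := rfl

/-- Coercivity of `A` on finitely supported vectors of `l²(ℤ^d)` (B4Sect5L2's `FinCoercive`), constant `min(2,a)`.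
[folklore] -/
theorem finCoercive_Aker (n : ℕ) (a : ℝ) :
    FinCoercive (kerA (Set.univ : Set (Fin d → ℤ)) (Aker (d := d) n a)) (min 2 a) := by
  classical
  intro s c
  have h := coercive_AX n a (s.map embX) (fun x => c (ofX x))
  simp only [Finset.sum_map, embX_apply, ofX_toX] at h
  exact h

/-- **(5.6) of B4 for `Δ^η + aQ*Q` on the whole lattice**: `Hyp56Z ℤ^d A (min 2 a) c₀ 1` — symmetric, `≥ min(2,a)·I` on
every finite `Λ`, finite-range entry bound.  For `a > 0` the B4 Sect. 5 Theorem (`B4Sect5Exhaustion`, `B4Sect5L2`)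
then gives `G'_j = A⁻¹` on `l²(ℤ^d)` with kernel `limInv ℤ^d A`.
[cite: Balaban1984PropagatorsII, p.236 («G'_j denotes the operator (Δ^{L^{−j}} + a_jQ'_j*Q'_j)^{−1} on the whole lattice L^{−j}Z^d»)] -/
theorem hyp56Z_Aker (n : ℕ) (a : ℝ) :
    Hyp56Z (Set.univ : Set (Fin d → ℤ)) (Aker (d := d) n a) (min 2 a) (c0 d n a) 1 where
  symm p q _ _ := AX_symm n a p.1 q.1
  coercive Λ hΛ v := hyp56Z_coercive_of_finCoercive (finCoercive_Aker n a) Λ hΛ v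
  decay p q _ _ := abs_AX_le n a p.1 q.1

/-! ## §5  The variational lower bound for a positive symmetric operator [folklore] -/

/-- **Variational principle**: if `T` is symmetric and positive on a real inner product space and `Tv = u`, then
`⟨u, v⟩ ≥ 2⟨u, f⟩ − ⟨Tf, f⟩` for every test vector `f` (expand `0 ≤ ⟨T(v − f), v − f⟩`). [folklore] -/
theorem inner_inv_ge {V : Type*} [NormedAddCommGroup V] [InnerProductSpace ℝ V] (T : V →L[ℝ] V)
    (hsymm : ∀ f g : V, inner ℝ (T f) g = inner ℝ f (T g)) (hpos : ∀ g : V, 0 ≤ inner ℝ (T g) g)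
    {u v : V} (hv : T v = u) (f : V) :
    2 * inner ℝ u f - inner ℝ (T f) f ≤ inner ℝ u v := by
  have h := hpos (v - f)
  rw [map_sub, inner_sub_left, inner_sub_right, inner_sub_right, hv] at h
  have h2 : inner ℝ (T f) v = inner ℝ u f := by rw [hsymm, hv, real_inner_comm]
  rw [h2] at h
  linarith

/-! ## §6  The block bump test function [folklore] -/

/-- `(p + e_μ)(μ) = p(μ) + 1`. [folklore] -/
theorem add_e_apply_self (p : X d) (μ : Fin d) : (p + e μ) μ = p μ + 1 := by simp

/-- `(p + e_μ)(ν) = p(ν)` for `ν ≠ μ`. [folklore] -/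
theorem add_e_apply_ne (p : X d) {μ ν : Fin d} (h : ν ≠ μ) : (p + e μ) ν = p ν := by simp [e_apply_ne h]

/-- One step inside a block: quotient unchanged, remainder `+1`. [folklore] -/
theorem ediv_emod_add_one_of_lt {n : ℕ} {x : ℤ} (h : x % side n < n) :
    (x + 1) / side n = x / side n ∧ (x + 1) % side n = x % side n + 1 := by
  have hs := (side_facts n).1
  have h0 := Int.emod_nonneg x hs.ne'
  have hx := Int.emod_def x (side n)
  have hsn : side n = n + 1 := rfl
  refine (Int.ediv_emod_unique hs).2 ⟨by linarith, by linarith, by linarith⟩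

/-- One step across a block face: quotient `+1`, remainder `0`. [folklore] -/
theorem ediv_emod_add_one_of_eq {n : ℕ} {x : ℤ} (h : x % side n = n) :
    (x + 1) / side n = x / side n + 1 ∧ (x + 1) % side n = 0 := by
  have hs := (side_facts n).1
  have hx := Int.emod_def x (side n)
  have hsn : side n = n + 1 := rfl
  refine (Int.ediv_emod_unique hs).2 ⟨?_, le_rfl, hs⟩
  rw [mul_add, mul_one, zero_add]
  linarith

/-- The step `+e_μ` inside a block: same block, local coordinate `+1`. [folklore] -/
theorem blk_add_e_of_lt {n : ℕ} {p : X d} {μ : Fin d} (h : loc n p μ < n) :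
    blk n (p + e μ) = blk n p ∧ loc n (p + e μ) μ = loc n p μ + 1 := by
  have key := ediv_emod_add_one_of_lt (n := n) (x := p μ) h
  refine ⟨funext fun ν => ?_, ?_⟩
  · by_cases hν : ν = μ
    · subst hν
      show (p + e ν) ν / side n = p ν / side n
      rw [add_e_apply_self]; exact key.1
    · show (p + e μ) ν / side n = p ν / side n
      rw [add_e_apply_ne p hν]
  · show (p + e μ) μ % side n = p μ % side n + 1
    rw [add_e_apply_self]; exact key.2

/-- The step `+e_μ` across a block face: local coordinate `0`. [folklore] -/
theorem loc_add_e_of_eq {n : ℕ} {p : X d} {μ : Fin d} (h : loc n p μ = n) : loc n (p + e μ) μ = 0 := by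
  have key := ediv_emod_add_one_of_eq (n := n) (x := p μ) h
  show (p + e μ) μ % side n = 0
  rw [add_e_apply_self]; exact key.2

/-- The step `+e_μ` does not change the other local coordinates. [folklore] -/
theorem loc_add_e_ne {n : ℕ} (p : X d) {μ ν : Fin d} (h : ν ≠ μ) : loc n (p + e μ) ν = loc n p ν := by
  show (p + e μ) ν % side n = p ν % side n
  rw [add_e_apply_ne p h]

/-- **The one-dimensional profile** `g(t) = (t+1)(n+1−t)/(n+1)²` of the local coordinate `t ∈ {0,…,n}`: a discrete
parabola with face values `g(0) = g(n) = 1/(n+1)`, `0 ≤ g ≤ 1`, and steps `|g(t+1) − g(t)| ≤ 1/(n+1)`. [folklore] -/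
def g1 (n : ℕ) (t : ℤ) : ℝ := ((t : ℝ) + 1) * (((n : ℝ) + 1) - t) / ((n : ℝ) + 1) ^ 2

/-- `g ≥ 0` on `0 ≤ t ≤ n`. [folklore] -/
theorem g1_nonneg {n : ℕ} {t : ℤ} (h0 : 0 ≤ t) (h1 : t ≤ n) : 0 ≤ g1 n t := by
  unfold g1
  have ht0 : (0 : ℝ) ≤ t := by exact_mod_cast h0
  have ht1 : (t : ℝ) ≤ n := by exact_mod_cast h1
  apply div_nonneg (mul_nonneg (by linarith) (by linarith)) (by positivity)

/-- `g ≤ 1` on `0 ≤ t ≤ n`. [folklore] -/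
theorem g1_le_one {n : ℕ} {t : ℤ} (h0 : 0 ≤ t) (h1 : t ≤ n) : g1 n t ≤ 1 := by
  unfold g1
  have ht0 : (0 : ℝ) ≤ t := by exact_mod_cast h0
  have ht1 : (t : ℝ) ≤ n := by exact_mod_cast h1
  rw [div_le_one (by positivity)]
  nlinarith

/-- Face value `g(0) = 1/(n+1)`. [folklore] -/
theorem g1_zero (n : ℕ) : g1 n 0 = 1 / ((n : ℝ) + 1) := by
  unfold g1
  have hs : (0 : ℝ) < (n : ℝ) + 1 := by positivity
  field_simp
  push_cast
  ring

/-- Face value `g(n) = 1/(n+1)`. [folklore] -/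
theorem g1_last (n : ℕ) : g1 n n = 1 / ((n : ℝ) + 1) := by
  unfold g1
  have hs : (0 : ℝ) < (n : ℝ) + 1 := by positivity
  field_simp
  push_cast
  ring

/-- Step bound `|g(t+1) − g(t)| ≤ 1/(n+1)` for `0 ≤ t ≤ n − 1`. [folklore] -/
theorem g1_step_abs {n : ℕ} {t : ℤ} (h0 : 0 ≤ t) (h1 : t + 1 ≤ n) :
    |g1 n (t + 1) - g1 n t| ≤ 1 / ((n : ℝ) + 1) := by
  unfold g1
  have hs : (0 : ℝ) < (n : ℝ) + 1 := by positivity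
  have ht0 : (0 : ℝ) ≤ t := by exact_mod_cast h0
  have ht1 : (t : ℝ) + 1 ≤ n := by exact_mod_cast h1
  have e1 : ((t + 1 : ℤ) : ℝ) = (t : ℝ) + 1 := by push_cast; ring
  rw [e1, div_sub_div_same, abs_div, abs_of_pos (by positivity : (0 : ℝ) < ((n : ℝ) + 1) ^ 2),
    div_le_div_iff₀ (by positivity) hs]
  have e2 : ((t : ℝ) + 1 + 1) * ((n : ℝ) + 1 - ((t : ℝ) + 1)) - ((t : ℝ) + 1) * ((n : ℝ) + 1 - t)
      = (n : ℝ) - 2 * t - 1 := by ring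
  rw [e2]
  have : |(n : ℝ) - 2 * t - 1| ≤ (n : ℝ) + 1 := by rw [abs_le]; constructor <;> linarith
  nlinarith

/-- **The block bump** `φ(p) = ∏_μ g(loc_μ(p))`: the same profile on every block, `1/(n+1)` on the block faces.
[folklore] -/
def bump (n : ℕ) (p : X d) : ℝ := ∏ μ, g1 n (loc n p μ)

/-- `0 ≤ φ`. [folklore] -/
theorem bump_nonneg (n : ℕ) (p : X d) : 0 ≤ bump n p :=
  Finset.prod_nonneg fun μ _ => g1_nonneg (loc_nonneg n p μ) (loc_le n p μ)

/-- `φ ≤ 1`. [folklore] -/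
theorem bump_le_one (n : ℕ) (p : X d) : bump n p ≤ 1 :=
  Finset.prod_le_one (fun μ _ => g1_nonneg (loc_nonneg n p μ) (loc_le n p μ))
    fun μ _ => g1_le_one (loc_nonneg n p μ) (loc_le n p μ)

/-- The partial product of the profile over the directions `≠ μ`. [folklore] -/
def rest (n : ℕ) (p : X d) (μ : Fin d) : ℝ := ∏ ν ∈ univ.erase μ, g1 n (loc n p ν)

/-- `0 ≤ rest ≤ 1`. [folklore] -/
theorem rest_nonneg (n : ℕ) (p : X d) (μ : Fin d) : 0 ≤ rest n p μ :=
  Finset.prod_nonneg fun ν _ => g1_nonneg (loc_nonneg n p ν) (loc_le n p ν)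

/-- `rest ≤ 1`. [folklore] -/
theorem rest_le_one (n : ℕ) (p : X d) (μ : Fin d) : rest n p μ ≤ 1 :=
  Finset.prod_le_one (fun ν _ => g1_nonneg (loc_nonneg n p ν) (loc_le n p ν))
    fun ν _ => g1_le_one (loc_nonneg n p ν) (loc_le n p ν)

/-- Splitting off direction `μ`: `φ(p) = g(loc_μ p)·rest`. [folklore] -/
theorem bump_eq_mul_rest (n : ℕ) (p : X d) (μ : Fin d) : bump n p = g1 n (loc n p μ) * rest n p μ :=
  (Finset.mul_prod_erase univ (fun ν => g1 n (loc n p ν)) (Finset.mem_univ μ)).symm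

/-- The other factors do not see the step `+e_μ`. [folklore] -/
theorem rest_add_e (n : ℕ) (p : X d) (μ : Fin d) : rest n (p + e μ) μ = rest n p μ :=
  Finset.prod_congr rfl fun ν hν => by rw [loc_add_e_ne p (Finset.ne_of_mem_erase hν)]

/-- **The test function** `F(p) = Λ(blk p)·φ(p)` for a profile `Λ` on the unit lattice. [folklore] -/
def F (n : ℕ) (Λ : X d → ℝ) (p : X d) : ℝ := Λ (blk n p) * bump n p

/-- **Bond estimate for the test function**: `|F(p+e_μ) − F(p)| ≤ (|Λ(blk p)| + |Λ(blk(p+e_μ))|)/(n+1)` (inside a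
block from the step bound of `g`; across a face from the face values `1/(n+1)`). [folklore] -/
theorem F_step_abs (n : ℕ) (Λ : X d → ℝ) (p : X d) (μ : Fin d) :
    |F n Λ (p + e μ) - F n Λ p| ≤ (|Λ (blk n p)| + |Λ (blk n (p + e μ))|) / ((n : ℝ) + 1) := by
  have hs : (0 : ℝ) < (n : ℝ) + 1 := by positivity
  have hR0 := rest_nonneg n p μ
  have hR1 := rest_le_one n p μ
  have hb : bump n p = g1 n (loc n p μ) * rest n p μ := bump_eq_mul_rest n p μ
  have hb' : bump n (p + e μ) = g1 n (loc n (p + e μ) μ) * rest n p μ := by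
    rw [bump_eq_mul_rest n (p + e μ) μ, rest_add_e]
  unfold F
  rw [hb, hb']
  rcases (loc_le n p μ).lt_or_eq with hlt | heq
  · obtain ⟨hblk, hloc⟩ := blk_add_e_of_lt hlt
    rw [hblk, hloc]
    have hst := g1_step_abs (n := n) (loc_nonneg n p μ) (by omega)
    have hA0 := abs_nonneg (Λ (blk n p))
    calc |Λ (blk n p) * (g1 n (loc n p μ + 1) * rest n p μ) - Λ (blk n p) * (g1 n (loc n p μ) * rest n p μ)|
        = |Λ (blk n p)| * |g1 n (loc n p μ + 1) - g1 n (loc n p μ)| * rest n p μ := by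
          rw [← mul_sub, ← sub_mul, abs_mul, abs_mul, abs_of_nonneg hR0]; ring
      _ ≤ |Λ (blk n p)| * (1 / ((n : ℝ) + 1)) * 1 :=
          mul_le_mul (mul_le_mul_of_nonneg_left hst hA0) hR1 hR0 (by positivity)
      _ ≤ (|Λ (blk n p)| + |Λ (blk n p)|) / ((n : ℝ) + 1) := by
          rw [mul_one, ← div_eq_mul_one_div, div_le_div_iff_of_pos_right hs]; linarith
  · rw [loc_add_e_of_eq heq, heq, g1_zero, g1_last]
    have hA0 := abs_nonneg (Λ (blk n p))
    have hA1 := abs_nonneg (Λ (blk n (p + e μ)))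
    calc |Λ (blk n (p + e μ)) * (1 / ((n : ℝ) + 1) * rest n p μ) - Λ (blk n p) * (1 / ((n : ℝ) + 1) * rest n p μ)|
        = |Λ (blk n (p + e μ)) - Λ (blk n p)| * (1 / ((n : ℝ) + 1)) * rest n p μ := by
          rw [← sub_mul, abs_mul, abs_mul, abs_of_nonneg hR0,
            abs_of_pos (by positivity : (0 : ℝ) < 1 / ((n : ℝ) + 1))]; ring
      _ ≤ (|Λ (blk n (p + e μ))| + |Λ (blk n p)|) * (1 / ((n : ℝ) + 1)) * 1 :=
          mul_le_mul (mul_le_mul_of_nonneg_right (abs_sub _ _) (by positivity)) hR1 hR0 (by positivity)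
      _ = (|Λ (blk n p)| + |Λ (blk n (p + e μ))|) / ((n : ℝ) + 1) := by
          rw [mul_one, ← div_eq_mul_one_div, add_comm]

/-- Squared bond estimate: `(F(p+e_μ) − F(p))² ≤ 2(Λ(blk p)² + Λ(blk(p+e_μ))²)/(n+1)²`. [folklore] -/
theorem F_step_sq (n : ℕ) (Λ : X d → ℝ) (p : X d) (μ : Fin d) :
    (F n Λ p - F n Λ (p + e μ)) ^ 2 ≤ 2 * (Λ (blk n p) ^ 2 + Λ (blk n (p + e μ)) ^ 2) / ((n : ℝ) + 1) ^ 2 := by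
  have hs : (0 : ℝ) < (n : ℝ) + 1 := by positivity
  have h := F_step_abs n Λ p μ
  have hA0 := abs_nonneg (Λ (blk n p))
  have hA1 := abs_nonneg (Λ (blk n (p + e μ)))
  have h0 : 0 ≤ |F n Λ (p + e μ) - F n Λ p| := abs_nonneg _
  have h1 : (F n Λ p - F n Λ (p + e μ)) ^ 2 = |F n Λ (p + e μ) - F n Λ p| ^ 2 := by
    rw [sq_abs]; ring
  have h2 : |F n Λ (p + e μ) - F n Λ p| ^ 2 ≤ ((|Λ (blk n p)| + |Λ (blk n (p + e μ))|) / ((n : ℝ) + 1)) ^ 2 :=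
    pow_le_pow_left₀ h0 h 2
  have h3 : ((|Λ (blk n p)| + |Λ (blk n (p + e μ))|) / ((n : ℝ) + 1)) ^ 2
      ≤ 2 * (Λ (blk n p) ^ 2 + Λ (blk n (p + e μ)) ^ 2) / ((n : ℝ) + 1) ^ 2 := by
    rw [div_pow, div_le_div_iff_of_pos_right (by positivity)]
    nlinarith [sq_abs (Λ (blk n p)), sq_abs (Λ (blk n (p + e μ))), sq_nonneg (|Λ (blk n p)| - |Λ (blk n (p + e μ))|)]
  rw [h1]; exact h2.trans h3

/-- **The block mass of the profile** `Θ₁ = Σ_{t=0}^{n} g(t)`. [folklore] -/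
def Theta1 (n : ℕ) : ℝ := ∑ k ∈ Finset.range (n + 1), g1 n (k : ℤ)

/-- A closed form for the auxiliary sum `Σ_{t<m} (t+1)(c−t)`. [folklore] -/
theorem sum_profile (c : ℝ) (m : ℕ) :
    ∑ t ∈ Finset.range m, ((t : ℝ) + 1) * (c - t)
      = c * ((m : ℝ) * ((m : ℝ) + 1) / 2) - ((m : ℝ) - 1) * m * ((m : ℝ) + 1) / 3 := by
  induction m with
  | zero => simp
  | succ m ih => rw [Finset.sum_range_succ, ih]; push_cast; ring

/-- `Θ₁ = (n+2)(n+3)/(6(n+1))`. [folklore] -/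
theorem Theta1_eq (n : ℕ) : Theta1 n = (((n : ℝ) + 2) * ((n : ℝ) + 3)) / (6 * ((n : ℝ) + 1)) := by
  unfold Theta1 g1
  have hs : (0 : ℝ) < (n : ℝ) + 1 := by positivity
  push_cast
  rw [← Finset.sum_div, sum_profile ((n : ℝ) + 1) (n + 1)]
  push_cast
  field_simp
  ring

/-- `Θ₁/(n+1) ≥ 1/6` (uniformly in the mesh). [folklore] -/
theorem Theta1_div_ge (n : ℕ) : 1 / 6 ≤ Theta1 n / ((n : ℝ) + 1) := by
  rw [Theta1_eq, div_div, le_div_iff₀ (by positivity)]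
  nlinarith [Nat.cast_nonneg (α := ℝ) n]

/-- `Θ₁/(n+1) ≤ 1`. [folklore] -/
theorem Theta1_div_le (n : ℕ) : Theta1 n / ((n : ℝ) + 1) ≤ 1 := by
  rw [Theta1_eq, div_div, div_le_one (by positivity)]
  nlinarith [Nat.cast_nonneg (α := ℝ) n]

/-- `Θ₁ ≥ 0`. [folklore] -/
theorem Theta1_nonneg (n : ℕ) : 0 ≤ Theta1 n := by
  rw [Theta1_eq]; positivity

/-- **The bump has block sum `Θ₁^d` on every block.** [folklore] -/
theorem sum_B_bump (n : ℕ) (y : X d) : ∑ p ∈ B n y, bump n p = Theta1 n ^ d := by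
  rw [sum_B]
  unfold bump
  simp_rw [loc_chart]
  rw [← Fintype.prod_sum fun (_μ : Fin d) (t : Fin (n + 1)) => g1 n ((t : ℕ) : ℤ)]
  rw [Finset.prod_const, Finset.card_univ, Fintype.card_fin]
  congr 1
  exact Fin.sum_univ_eq_sum_range (fun k => g1 n (k : ℤ)) (n + 1)

/-! ## §7  The three finite-sum computations behind the variational bound [folklore] -/

/-- Off the union of the blocks of `S`, the block profile `(ext S c) ∘ blk` vanishes. [folklore] -/
theorem ext_blk_eq_zero {n : ℕ} {S : Finset (X d)} (c : X d → ℝ) {r : X d} (hr : r ∉ U n S) :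
    ext S c (blk n r) = 0 :=
  ext_of_not_mem fun h => hr (mem_U.2 h)

/-- `Σ_{r ∈ U} Λ(blk r)² = (n+1)^d Σ_S c²` for `Λ = ext S c`. [folklore] -/
theorem sum_U_sq (n : ℕ) (S : Finset (X d)) (c : X d → ℝ) :
    ∑ r ∈ U n S, ext S c (blk n r) ^ 2 = ((n : ℝ) + 1) ^ d * ∑ y ∈ S, c y ^ 2 := by
  rw [sum_U, Finset.mul_sum]
  refine Finset.sum_congr rfl fun y hy => ?_
  calc ∑ r ∈ B n y, ext S c (blk n r) ^ 2 = ∑ _r ∈ B n y, c y ^ 2 :=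
        Finset.sum_congr rfl fun r hr => by rw [mem_B.1 hr, ext_of_mem hy]
    _ = ((n : ℝ) + 1) ^ d * c y ^ 2 := sum_B_const y _

/-- For ANY finite `T`: `Σ_{r ∈ T} Λ(blk r)² ≤ (n+1)^d Σ_S c²` (the profile vanishes off `U`). [folklore] -/
theorem sum_sq_blk_le (n : ℕ) (S : Finset (X d)) (c : X d → ℝ) (T : Finset (X d)) :
    ∑ r ∈ T, ext S c (blk n r) ^ 2 ≤ ((n : ℝ) + 1) ^ d * ∑ y ∈ S, c y ^ 2 := by
  classical
  rw [← sum_U_sq]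
  calc ∑ r ∈ T, ext S c (blk n r) ^ 2 = ∑ r ∈ T with r ∈ U n S, ext S c (blk n r) ^ 2 := by
        rw [Finset.sum_filter_of_ne]
        intro r _ hne
        by_contra hr
        exact hne (by rw [ext_blk_eq_zero c hr]; ring)
    _ ≤ ∑ r ∈ U n S, ext S c (blk n r) ^ 2 :=
        Finset.sum_le_sum_of_subset_of_nonneg (fun r hr => (Finset.mem_filter.1 hr).2) fun _ _ _ => sq_nonneg _

/-- **(i) The pairing** `Σ_{x∈U} Λ(blk x)·F(x) = Θ₁^d Σ_S c²`. [folklore] -/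
theorem pair_sum (n : ℕ) (S : Finset (X d)) (c : X d → ℝ) :
    ∑ x ∈ U n S, ext S c (blk n x) * F n (ext S c) x = Theta1 n ^ d * ∑ y ∈ S, c y ^ 2 := by
  rw [sum_U, Finset.mul_sum]
  refine Finset.sum_congr rfl fun y hy => ?_
  calc ∑ x ∈ B n y, ext S c (blk n x) * F n (ext S c) x = ∑ x ∈ B n y, c y ^ 2 * bump n x :=
        Finset.sum_congr rfl fun x hx => by unfold F; rw [mem_B.1 hx, ext_of_mem hy]; ring
    _ = Theta1 n ^ d * c y ^ 2 := by rw [← Finset.mul_sum, sum_B_bump]; ring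

/-- **(ii) The Green pairing, block by block**: for any kernel `L`,
`Σ_{x,x'∈U} Λ(blk x) L(x,x') Λ(blk x') = Σ_{y,y'∈S} c(y) (Σ_{p∈B(y)} Σ_{q∈B(y')} L(p,q)) c(y')`. [folklore] -/
theorem green_sum (n : ℕ) (S : Finset (X d)) (c : X d → ℝ) (L : X d → X d → ℝ) :
    ∑ x ∈ U n S, (∑ x' ∈ U n S, L x x' * ext S c (blk n x')) * ext S c (blk n x)
      = ∑ y ∈ S, c y * ∑ y' ∈ S, (∑ p ∈ B n y, ∑ q ∈ B n y', L p q) * c y' := by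
  rw [sum_U]
  refine Finset.sum_congr rfl fun y hy => ?_
  calc ∑ p ∈ B n y, (∑ x' ∈ U n S, L p x' * ext S c (blk n x')) * ext S c (blk n p)
      = ∑ p ∈ B n y, c y * ∑ y' ∈ S, c y' * ∑ q ∈ B n y', L p q := by
        refine Finset.sum_congr rfl fun p hp => ?_
        rw [mem_B.1 hp, ext_of_mem hy, mul_comm, sum_U]
        congr 1
        refine Finset.sum_congr rfl fun y' hy' => ?_
        rw [Finset.mul_sum]
        exact Finset.sum_congr rfl fun q hq => by rw [mem_B.1 hq, ext_of_mem hy', mul_comm]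
    _ = c y * ∑ p ∈ B n y, ∑ y' ∈ S, c y' * ∑ q ∈ B n y', L p q := by rw [← Finset.mul_sum]
    _ = c y * ∑ y' ∈ S, ∑ p ∈ B n y, c y' * ∑ q ∈ B n y', L p q := by rw [Finset.sum_comm]
    _ = c y * ∑ y' ∈ S, (∑ p ∈ B n y, ∑ q ∈ B n y', L p q) * c y' := by
        congr 1
        refine Finset.sum_congr rfl fun y' _ => ?_
        rw [Finset.sum_mul]
        exact Finset.sum_congr rfl fun p _ => mul_comm _ _

/-- **(iii) The energy of the test function**: `⟨F, AF⟩ ≤ (4d(n+1)^d + a(n+1)^{−d}Θ₁^{2d}) Σ_S c²` — the Dirichlet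
part from the bond estimate (`|∇F| ≲ |Λ|/(n+1)`, `(n+1)^d` sites per block, the factor `(n+1)²` of `Δ^η` cancels),
the block part from `Σ_{B(y)} F = Λ(y)Θ₁^d`. [folklore] -/
theorem form_sum_le (n : ℕ) {a : ℝ} (ha : 0 ≤ a) (S : Finset (X d)) (c : X d → ℝ) :
    ∑ x ∈ U n S, F n (ext S c) x * ∑ x' ∈ U n S, AX n a x x' * F n (ext S c) x'
      ≤ (4 * d * ((n : ℝ) + 1) ^ d + a / ((n : ℝ) + 1) ^ d * (Theta1 n ^ d) ^ 2) * ∑ y ∈ S, c y ^ 2 := by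
  classical
  have hs : (0 : ℝ) < (n : ℝ) + 1 := by positivity
  have hSU := subset_U_image n (U n S)
  have hSP : U n S ⊆ Pset n ((U n S).image (blk n)) := hSU.trans (U_subset_Pset n _)
  have hSP' : ∀ μ, ∀ p ∈ U n S, p - e μ ∈ Pset n ((U n S).image (blk n)) :=
    fun μ p hp => sub_e_mem_Pset μ (hSU hp)
  rw [form_AX_split, lapForm_eq (U n S) _ hSP hSP' (F n (ext S c)), blkForm_eq n (U n S) (F n (ext S c))]
  have hext : ∀ r, ext (U n S) (F n (ext S c)) r = F n (ext S c) r := by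
    intro r
    by_cases hr : r ∈ U n S
    · exact ext_of_mem hr
    · rw [ext_of_not_mem hr]; unfold F; rw [ext_blk_eq_zero c hr, zero_mul]
  simp only [hext]
  -- Dirichlet part, one direction at a time
  have hD : ∀ μ, ∑ r ∈ Pset n ((U n S).image (blk n)), (F n (ext S c) r - F n (ext S c) (r + e μ)) ^ 2
      ≤ 4 * ((n : ℝ) + 1) ^ d / ((n : ℝ) + 1) ^ 2 * ∑ y ∈ S, c y ^ 2 := by
    intro μ
    have h2 : ∑ r ∈ Pset n ((U n S).image (blk n)), ext S c (blk n (r + e μ)) ^ 2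
        ≤ ((n : ℝ) + 1) ^ d * ∑ y ∈ S, c y ^ 2 := by
      have := sum_sq_blk_le n S c ((Pset n ((U n S).image (blk n))).map (addRightEmbedding (e μ)))
      simpa [Finset.sum_map] using this
    have h3 := sum_sq_blk_le n S c (Pset n ((U n S).image (blk n)))
    calc ∑ r ∈ Pset n ((U n S).image (blk n)), (F n (ext S c) r - F n (ext S c) (r + e μ)) ^ 2
        ≤ ∑ r ∈ Pset n ((U n S).image (blk n)),
            2 * (ext S c (blk n r) ^ 2 + ext S c (blk n (r + e μ)) ^ 2) / ((n : ℝ) + 1) ^ 2 :=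
          Finset.sum_le_sum fun r _ => F_step_sq n (ext S c) r μ
      _ = 2 / ((n : ℝ) + 1) ^ 2 * (∑ r ∈ Pset n ((U n S).image (blk n)), ext S c (blk n r) ^ 2
            + ∑ r ∈ Pset n ((U n S).image (blk n)), ext S c (blk n (r + e μ)) ^ 2) := by
          rw [← Finset.sum_add_distrib, Finset.mul_sum]
          exact Finset.sum_congr rfl fun r _ => by ring
      _ ≤ 2 / ((n : ℝ) + 1) ^ 2 * (((n : ℝ) + 1) ^ d * ∑ y ∈ S, c y ^ 2 + ((n : ℝ) + 1) ^ d * ∑ y ∈ S, c y ^ 2) :=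
          mul_le_mul_of_nonneg_left (add_le_add h3 h2) (by positivity)
      _ = 4 * ((n : ℝ) + 1) ^ d / ((n : ℝ) + 1) ^ 2 * ∑ y ∈ S, c y ^ 2 := by ring
  -- block part
  have hYS : (U n S).image (blk n) ⊆ S := by
    intro y hy
    obtain ⟨q, hq, rfl⟩ := Finset.mem_image.1 hy
    exact mem_U.1 hq
  have hval : ∀ y ∈ (U n S).image (blk n),
      ∑ q ∈ U n S with blk n q = y, F n (ext S c) q = ext S c y * Theta1 n ^ d := by
    intro y _
    rw [sum_filter_blk_eq n (U n S) (F n (ext S c)) y]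
    simp only [hext]
    rw [← sum_B y (F n (ext S c))]
    calc ∑ p ∈ B n y, F n (ext S c) p = ∑ p ∈ B n y, ext S c y * bump n p :=
          Finset.sum_congr rfl fun p hp => by unfold F; rw [mem_B.1 hp]
      _ = ext S c y * Theta1 n ^ d := by rw [← Finset.mul_sum, sum_B_bump]
  have hB : ∑ y ∈ (U n S).image (blk n), (∑ q ∈ U n S with blk n q = y, F n (ext S c) q) ^ 2
      ≤ (Theta1 n ^ d) ^ 2 * ∑ y ∈ S, c y ^ 2 := by
    calc ∑ y ∈ (U n S).image (blk n), (∑ q ∈ U n S with blk n q = y, F n (ext S c) q) ^ 2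
        = ∑ y ∈ (U n S).image (blk n), (Theta1 n ^ d) ^ 2 * ext S c y ^ 2 :=
          Finset.sum_congr rfl fun y hy => by rw [hval y hy]; ring
      _ ≤ ∑ y ∈ S, (Theta1 n ^ d) ^ 2 * ext S c y ^ 2 :=
          Finset.sum_le_sum_of_subset_of_nonneg hYS fun _ _ _ => by positivity
      _ = (Theta1 n ^ d) ^ 2 * ∑ y ∈ S, c y ^ 2 := by
          rw [Finset.mul_sum]
          exact Finset.sum_congr rfl fun y hy => by rw [ext_of_mem hy]
  -- assemble
  have hsd0 : 0 ≤ a / ((n : ℝ) + 1) ^ d := div_nonneg ha (by positivity)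
  calc ((n : ℝ) + 1) ^ 2 * ∑ μ : Fin d, ∑ r ∈ Pset n ((U n S).image (blk n)),
          (F n (ext S c) r - F n (ext S c) (r + e μ)) ^ 2
        + a / ((n : ℝ) + 1) ^ d
          * ∑ y ∈ (U n S).image (blk n), (∑ q ∈ U n S with blk n q = y, F n (ext S c) q) ^ 2
      ≤ ((n : ℝ) + 1) ^ 2 * ∑ _μ : Fin d, 4 * ((n : ℝ) + 1) ^ d / ((n : ℝ) + 1) ^ 2 * ∑ y ∈ S, c y ^ 2
        + a / ((n : ℝ) + 1) ^ d * ((Theta1 n ^ d) ^ 2 * ∑ y ∈ S, c y ^ 2) :=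
        add_le_add (mul_le_mul_of_nonneg_left (Finset.sum_le_sum fun μ _ => hD μ) (by positivity))
          (mul_le_mul_of_nonneg_left hB hsd0)
    _ = (4 * d * ((n : ℝ) + 1) ^ d + a / ((n : ℝ) + 1) ^ d * (Theta1 n ^ d) ^ 2) * ∑ y ∈ S, c y ^ 2 := by
        rw [Finset.sum_const, Finset.card_univ, Fintype.card_fin, nsmul_eq_mul]
        field_simp

/-- **The scalar optimisation** behind the constant: with `σ = 6^{−d} ≤ θ ≤ 1` and `τ = σ/(4d+a)`,
`2τθ − τ²(4d + aθ²) ≥ σ²/(4d+a) = 1/(36^d(4d+a))`. [folklore] -/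
theorem scalar_key (d : ℕ) {a θ : ℝ} (ha : 0 < a) (hθlo : (1 / 6 : ℝ) ^ d ≤ θ) (hθhi : θ ≤ 1) :
    1 / ((36 : ℝ) ^ d * (4 * d + a))
      ≤ 2 * ((1 / 6 : ℝ) ^ d / (4 * d + a)) * θ - ((1 / 6 : ℝ) ^ d / (4 * d + a)) ^ 2 * (4 * d + a * θ ^ 2) := by
  set σ := (1 / 6 : ℝ) ^ d with hσ
  have hden : (0 : ℝ) < 4 * d + a := by positivity
  have hσ0 : 0 < σ := by positivity
  have hθ0 : 0 ≤ θ := hσ0.le.trans hθlo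
  have hθ2 : θ ^ 2 ≤ 1 := pow_le_one₀ hθ0 hθhi
  have hσ2 : σ ^ 2 = 1 / (36 : ℝ) ^ d := by
    rw [hσ, ← pow_mul, mul_comm d 2, pow_mul]
    norm_num [one_div_pow]
  have hL : 1 / ((36 : ℝ) ^ d * (4 * d + a)) = σ ^ 2 / (4 * d + a) := by
    rw [hσ2]; field_simp
  rw [hL]
  have key : 0 ≤ 2 * σ * θ * (4 * d + a) - σ ^ 2 * (4 * d + a * θ ^ 2) - σ ^ 2 * (4 * d + a) := by
    nlinarith [mul_nonneg (mul_nonneg hσ0.le hden.le) (sub_nonneg.2 hθlo),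
      mul_nonneg (mul_nonneg (sq_nonneg σ) ha.le) (sub_nonneg.2 hθ2)]
  have e : 2 * (σ / (4 * d + a)) * θ - (σ / (4 * d + a)) ^ 2 * (4 * d + a * θ ^ 2) - σ ^ 2 / (4 * d + a)
      = (2 * σ * θ * (4 * d + a) - σ ^ 2 * (4 * d + a * θ ^ 2) - σ ^ 2 * (4 * d + a)) / (4 * d + a) ^ 2 := by
    field_simp
  have : 0 ≤ 2 * (σ / (4 * d + a)) * θ - (σ / (4 * d + a)) ^ 2 * (4 * d + a * θ ^ 2) - σ ^ 2 / (4 * d + a) := by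
    rw [e]; positivity
  linarith

/-! ## §8  The Fourier-free lower bound (2.76): `Q'_jG'_jQ'_j* ≥ 2γ₀` with `2γ₀ = 1/(36^d(4d + a))` -/

/-- `ofX` is injective. [folklore] -/
theorem ofX_injective : Function.Injective (ofX (d := d)) := fun x y h => by
  have := congrArg toX h
  simpa using this

/-- The sites as an embedding into the index type of `l²(ℤ^d)`. [folklore] -/
def embI : X d ↪ idx 1 (Set.univ : Set (Fin d → ℤ)) := ⟨ofX, ofX_injective⟩

/-- Values of the embedding. [folklore] -/
@[simp] theorem embI_apply (x : X d) : embI x = ofX x := rfl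

/-- The underlying B4 index of a site is `(x, 0)`. [folklore] -/
@[simp] theorem ofX_val (x : X d) : (ofX x).1 = (x, 0) := rfl

/-- **THE KERNEL OF `Q'_jG'_jQ'_j*` ON THE UNIT LATTICE `ℤ^d`** (scalar case `U = 1`, site coordinates):
`(Q'G'Q'*)(y, y') = (n+1)^{−d} Σ_{p ∈ B(y)} Σ_{q ∈ B(y')} G'(p, q)`, where `G' = (Δ^η + aQ*Q)^{−1}` on the whole
`η = (n+1)^{−1}`-lattice is the B4 Sect. 5 inverse kernel `limInv ℤ^d A` of the site matrix `A = AX n a`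
(`(Q'f)(y) = (n+1)^{−d} Σ_{p∈B(y)} f(p)·η^d·η^{−d}` — block averaging; `Q'*` its `l²`-adjoint).
[cite: Balaban1984PropagatorsII, (2.75)–(2.76) p.236] -/
def kerQGQ (n : ℕ) (a : ℝ) (y y' : X d) : ℝ :=
  (((n : ℝ) + 1) ^ d)⁻¹ * ∑ p ∈ B n y, ∑ q ∈ B n y', limInv Set.univ (Aker n a) (p, 0) (q, 0)

/-- **B6 (2.76), scalar case, on the whole unit lattice `ℤ^d`, uniformly in the mesh `η = (n+1)^{−1}`:**
`Q'_jG'_jQ'_j* ≥ 2γ₀` with `2γ₀ = 1/(36^d(4d + a))`, i.e. for every finitely supported `c`,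
`(36^d(4d+a))^{−1} Σ_y c(y)² ≤ Σ_{y,y'} c(y) (Q'G'Q'*)(y,y') c(y')`.
Print: «From this representation and the bounds (2.50), (2.51) of that paper it follows that Q'_jG'_jQ'_j* ≥ 2γ₀;
(2.76) γ₀ is a positive, absolute constant (a = 1).»  Here proved WITHOUT the Fourier representation (2.75), by the
variational principle `⟨u, A^{−1}u⟩ ≥ 2⟨u, f⟩ − ⟨f, Af⟩` with `u = Q'*c` and the block-bump test function
`f = τ·(c∘blk)·φ`; our `2γ₀` depends on `d` and `a` only (print: absolute for `a = 1`).
[cite: Balaban1984PropagatorsII, (2.76) p.236] -/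
theorem qGq_lower (n : ℕ) {a : ℝ} (ha : 0 < a) (S : Finset (X d)) (c : X d → ℝ) :
    1 / ((36 : ℝ) ^ d * (4 * d + a)) * ∑ y ∈ S, c y ^ 2
      ≤ ∑ y ∈ S, c y * ∑ y' ∈ S, kerQGQ n a y y' * c y' := by
  classical
  have hs : (0 : ℝ) < (n : ℝ) + 1 := by positivity
  have hsd : (0 : ℝ) < ((n : ℝ) + 1) ^ d := by positivity
  have hden : (0 : ℝ) < 4 * d + a := by positivity
  have hA := hyp56Z_Aker (d := d) n a
  have hγ : 0 < min 2 a := lt_min two_pos ha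
  have hc : 0 < c0 d n a := c0_pos d n ha.ne'
  have hC0 : 0 ≤ ∑ y ∈ S, c y ^ 2 := Finset.sum_nonneg fun _ _ => sq_nonneg _
  -- the data of the variational principle
  let τ : ℝ := (1 / 6 : ℝ) ^ d / (4 * d + a)
  let I : Finset (idx 1 (Set.univ : Set (Fin d → ℤ))) := (U n S).map embI
  let cu : idx 1 (Set.univ : Set (Fin d → ℤ)) → ℝ := fun i => ext S c (blk n (toX i))
  let cf : idx 1 (Set.univ : Set (Fin d → ℤ)) → ℝ := fun i => τ * F n (ext S c) (toX i)
  let u : H (idx 1 (Set.univ : Set (Fin d → ℤ))) := fs I cu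
  let f : H (idx 1 (Set.univ : Set (Fin d → ℤ))) := fs I cf
  let v : H (idx 1 (Set.univ : Set (Fin d → ℤ))) := (opAEquiv hA hγ hc.le one_pos).symm u
  have hTv : opA Set.univ (Aker n a) hA.decay hc.le one_pos v = u := opA_inv_apply hA hγ hc.le one_pos u
  -- (1) the pairing ⟨u, f⟩ = τ Θ Σ c²
  have h1 : inner ℝ u f = τ * (Theta1 n ^ d * ∑ y ∈ S, c y ^ 2) := by
    show inner ℝ (fs I cu) (fs I cf) = _
    rw [inner_eq_tsum, tsum_mul_fs]
    rw [show ∑ i ∈ I, fs I cu i * cf i = ∑ i ∈ I, cu i * cf i from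
      Finset.sum_congr rfl fun i hi => by rw [fs_apply, if_pos hi]]
    show ∑ i ∈ (U n S).map embI, ext S c (blk n (toX i)) * (τ * F n (ext S c) (toX i)) = _
    rw [Finset.sum_map]
    simp only [embI_apply, toX_ofX]
    rw [← pair_sum n S c, Finset.mul_sum]
    exact Finset.sum_congr rfl fun x _ => by ring
  -- (2) the energy ⟨Af, f⟩ ≤ τ² (4d s^d + a s^{-d} Θ²) Σ c²
  have h2 : inner ℝ (opA Set.univ (Aker n a) hA.decay hc.le one_pos f) f
      ≤ τ ^ 2 * ((4 * d * ((n : ℝ) + 1) ^ d + a / ((n : ℝ) + 1) ^ d * (Theta1 n ^ d) ^ 2)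
          * ∑ y ∈ S, c y ^ 2) := by
    show inner ℝ (kernelOp (schurBound_kerA hA.decay hc.le one_pos) (fs I cf)) (fs I cf) ≤ _
    rw [inner_kernelOp_fs]
    show ∑ i ∈ (U n S).map embI, τ * F n (ext S c) (toX i) *
        ∑ j ∈ (U n S).map embI, kerA Set.univ (Aker n a) i j * (τ * F n (ext S c) (toX j)) ≤ _
    rw [Finset.sum_map]
    simp_rw [Finset.sum_map]
    simp only [embI_apply, toX_ofX, kerA, Aker, ofX_val]
    calc ∑ x ∈ U n S, τ * F n (ext S c) x * ∑ x' ∈ U n S, AX n a x x' * (τ * F n (ext S c) x')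
        = τ ^ 2 * ∑ x ∈ U n S, F n (ext S c) x * ∑ x' ∈ U n S, AX n a x x' * F n (ext S c) x' := by
          rw [Finset.mul_sum]
          refine Finset.sum_congr rfl fun x _ => ?_
          rw [Finset.mul_sum, Finset.mul_sum, Finset.mul_sum]
          exact Finset.sum_congr rfl fun x' _ => by ring
      _ ≤ _ := mul_le_mul_of_nonneg_left (form_sum_le n ha.le S c) (sq_nonneg τ)
  -- (3) the Green pairing ⟨u, A⁻¹u⟩ = s^d Σ c (Q'G'Q'*) c
  have h3 : inner ℝ u v = ((n : ℝ) + 1) ^ d * ∑ y ∈ S, c y * ∑ y' ∈ S, kerQGQ n a y y' * c y' := by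
    rw [inner_eq_tsum]
    rw [show (∑' i, u i * v i) = ∑' i, v i * u i from tsum_congr fun i => mul_comm _ _]
    show (∑' i, v i * fs I cu i) = _
    rw [tsum_mul_fs]
    have hvi : ∀ i, v i = ∑ q ∈ I, G hA hγ hc.le one_pos i q * cu q := fun i => by
      show (opAEquiv hA hγ hc.le one_pos).symm (fs I cu) i = _
      rw [inv_apply_eq_tsum, tsum_mul_fs]
    simp only [hvi, G_eq_limInv hA hγ hc one_pos]
    show ∑ i ∈ (U n S).map embI, (∑ q ∈ (U n S).map embI,
        limInv Set.univ (Aker n a) i.1 q.1 * ext S c (blk n (toX q))) * ext S c (blk n (toX i)) = _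
    rw [Finset.sum_map]
    simp_rw [Finset.sum_map]
    simp only [embI_apply, toX_ofX, ofX_val]
    rw [green_sum n S c (fun x x' => limInv Set.univ (Aker n a) (x, 0) (x', 0))]
    have hk : ∀ y y' : X d, ((n : ℝ) + 1) ^ d * kerQGQ n a y y'
        = ∑ p ∈ B n y, ∑ q ∈ B n y', limInv Set.univ (Aker n a) (p, 0) (q, 0) := fun y y' => by
      unfold kerQGQ
      rw [← mul_assoc, mul_inv_cancel₀ hsd.ne', one_mul]
    simp only [← hk, Finset.mul_sum]
    exact Finset.sum_congr rfl fun y _ => Finset.sum_congr rfl fun y' _ => by ring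
  -- (4) the variational principle
  have hpos : ∀ g, 0 ≤ inner ℝ (opA Set.univ (Aker n a) hA.decay hc.le one_pos g) g := fun g =>
    (mul_nonneg hγ.le (sq_nonneg ‖g‖)).trans (inner_opA_self_ge hA hc.le one_pos g)
  have h4 := inner_inv_ge (opA Set.univ (Aker n a) hA.decay hc.le one_pos)
    (opA_symmetric hA.decay hc.le one_pos hA.symm) hpos hTv f
  -- (5) bookkeeping: Θ = θ s^d with 6^{-d} ≤ θ ≤ 1
  have hθlo : (1 / 6 : ℝ) ^ d ≤ (Theta1 n / ((n : ℝ) + 1)) ^ d :=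
    pow_le_pow_left₀ (by norm_num) (Theta1_div_ge n) d
  have hθhi : (Theta1 n / ((n : ℝ) + 1)) ^ d ≤ 1 :=
    pow_le_one₀ (div_nonneg (Theta1_nonneg n) hs.le) (Theta1_div_le n)
  have hΘ : Theta1 n ^ d = (Theta1 n / ((n : ℝ) + 1)) ^ d * ((n : ℝ) + 1) ^ d := by
    rw [div_pow, div_mul_cancel₀ _ hsd.ne']
  have hkey := scalar_key d ha hθlo hθhi
  have h5 : ((n : ℝ) + 1) ^ d *
      ((2 * ((1 / 6 : ℝ) ^ d / (4 * d + a)) * (Theta1 n / ((n : ℝ) + 1)) ^ d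
        - ((1 / 6 : ℝ) ^ d / (4 * d + a)) ^ 2 * (4 * d + a * ((Theta1 n / ((n : ℝ) + 1)) ^ d) ^ 2))
        * ∑ y ∈ S, c y ^ 2)
      ≤ ((n : ℝ) + 1) ^ d * ∑ y ∈ S, c y * ∑ y' ∈ S, kerQGQ n a y y' * c y' := by
    have e : ((n : ℝ) + 1) ^ d *
        ((2 * ((1 / 6 : ℝ) ^ d / (4 * d + a)) * (Theta1 n / ((n : ℝ) + 1)) ^ d
          - ((1 / 6 : ℝ) ^ d / (4 * d + a)) ^ 2 * (4 * d + a * ((Theta1 n / ((n : ℝ) + 1)) ^ d) ^ 2))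
          * ∑ y ∈ S, c y ^ 2)
        = 2 * (τ * (Theta1 n ^ d * ∑ y ∈ S, c y ^ 2))
          - τ ^ 2 * ((4 * d * ((n : ℝ) + 1) ^ d + a / ((n : ℝ) + 1) ^ d * (Theta1 n ^ d) ^ 2)
              * ∑ y ∈ S, c y ^ 2) := by
      have hτ : τ = (1 / 6 : ℝ) ^ d / (4 * d + a) := rfl
      rw [hτ, hΘ]
      field_simp
    rw [e, ← h1, ← h3]
    linarith [h2, h4]
  have h6 := le_of_mul_le_mul_left h5 hsd
  exact (mul_le_mul_of_nonneg_right hkey hC0).trans h6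

/-! ## §9  `G'_j` and `(Q'_jG'_jQ'_j*)^{−1}` exist on `l²(ℤ^d)`: condition (5.6) of B4 for both kernels -/

/-- **`G'_j = (Δ^η + aQ*Q)^{−1}` exists on `l²` of the whole fine lattice**, `‖G'_j‖ ≤ (min(2,a))^{−1}`, and its
kernel is the B4 Sect. 5 infinite-volume inverse kernel `limInv ℤ^d A` (exponentially decaying, mesh-dependent rate).
Print: «G'_j denotes the operator (Δ^{L^{−j}} + a_jQ'_j*Q'_j)^{−1} on the whole lattice L^{−j}Z^d. In [3] an explicit
representation of this operator was found».  [cite: Balaban1984PropagatorsII, p.236] -/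
theorem gPrime_exists (n : ℕ) {a : ℝ} (ha : 0 < a) :
    ∃ E : H (idx 1 (Set.univ : Set (Fin d → ℤ))) ≃L[ℝ] H (idx 1 (Set.univ : Set (Fin d → ℤ))),
      (∀ f, E f = opA Set.univ (Aker n a) (hyp56Z_Aker n a).decay (c0_pos d n ha.ne').le one_pos f)
      ∧ ‖(E.symm : H (idx 1 (Set.univ : Set (Fin d → ℤ))) →L[ℝ] H (idx 1 (Set.univ : Set (Fin d → ℤ))))‖
          ≤ (min 2 a)⁻¹
      ∧ ∀ w p, E.symm w p = ∑' q, limInv Set.univ (Aker n a) p.1 q.1 * w q := by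
  refine ⟨opAEquiv (hyp56Z_Aker n a) (lt_min two_pos ha) (c0_pos d n ha.ne').le one_pos,
    fun f => opAEquiv_apply _ _ _ _ f, norm_inv_le _ _ _ _, fun w p => ?_⟩
  rw [inv_apply_eq_tsum]
  exact tsum_congr fun q => by rw [G_eq_limInv _ _ (c0_pos d n ha.ne') one_pos]

/-- `Q'G'Q'*` as a B4 kernel on `ℤ^d × Fin 1` (scalar case `N = 1`). [folklore] -/
def KerQGQ (n : ℕ) (a : ℝ) : K d 1 → K d 1 → ℝ := fun y y' => kerQGQ n a y.1 y'.1

/-- **Symmetry of `Q'G'Q'*`** (from the symmetry of `G'`, `B4Sect5Exhaustion.limInv_symm`). [folklore] -/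
theorem kerQGQ_symm (n : ℕ) {a : ℝ} (ha : 0 < a) (y y' : X d) : kerQGQ n a y y' = kerQGQ n a y' y := by
  have hγ : 0 < min 2 a := lt_min two_pos ha
  have hc : 0 < c0 d n a := c0_pos d n ha.ne'
  unfold kerQGQ
  congr 1
  rw [Finset.sum_comm]
  exact Finset.sum_congr rfl fun q _ => Finset.sum_congr rfl fun p _ =>
    limInv_symm hγ hc one_pos (hyp56Z_Aker n a) (p, 0) (q, 0)

/-- Block labels are no farther apart than their sites, up to the block size: `|y − y'| ≤ |p − q| + n` for
`p ∈ B(y)`, `q ∈ B(y')`. [folklore] -/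
theorem dist_blk_le {n : ℕ} {y y' p q : X d} (hp : p ∈ B n y) (hq : q ∈ B n y') :
    dist y y' ≤ dist p q + n := by
  refine (dist_pi_le_iff (by positivity)).2 fun μ => ?_
  have h1 := side_mul_blk_add_loc n p μ
  have h2 := side_mul_blk_add_loc n q μ
  rw [mem_B.1 hp] at h1
  rw [mem_B.1 hq] at h2
  have l1 := loc_nonneg n p μ; have l2 := loc_le n p μ
  have l3 := loc_nonneg n q μ; have l4 := loc_le n q μ
  have hd : dist (p μ) (q μ) ≤ dist p q := dist_le_pi_dist p q μ
  rw [Int.dist_eq] at hd ⊢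
  have hs1 : (1 : ℤ) ≤ side n := (side_facts n).2
  have e : p μ - q μ = side n * (y μ - y' μ) + (loc n p μ - loc n q μ) := by rw [← h1, ← h2]; ring
  have hZ : |y μ - y' μ| ≤ |p μ - q μ| + n := by
    have a1 : |y μ - y' μ| ≤ |side n * (y μ - y' μ)| := by
      rw [abs_mul, abs_of_pos (side_facts n).1]
      exact le_mul_of_one_le_left (abs_nonneg _) hs1
    have a2 : |side n * (y μ - y' μ)| ≤ |p μ - q μ| + |loc n p μ - loc n q μ| := by
      rw [show side n * (y μ - y' μ) = (p μ - q μ) - (loc n p μ - loc n q μ) by rw [e]; ring]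
      exact abs_sub _ _
    have a3 : |loc n p μ - loc n q μ| ≤ n := by rw [abs_le]; constructor <;> linarith
    linarith
  have hR : |((y μ : ℤ) : ℝ) - ((y' μ : ℤ) : ℝ)| ≤ |((p μ : ℤ) : ℝ) - ((q μ : ℤ) : ℝ)| + n := by
    exact_mod_cast hZ
  linarith

/-- The lower constant `2γ₀ = 1/(36^d(4d+a))` of (2.76) (ours; print: «γ₀ is a positive, absolute constant (a = 1)»).
[cite: Balaban1984PropagatorsII, (2.76) p.236] -/
def gammaQ (d : ℕ) (a : ℝ) : ℝ := 1 / ((36 : ℝ) ^ d * (4 * d + a))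

/-- The (mesh-dependent) entry-bound constant of `Q'G'Q'*` inherited from B4 (5.7) for `G'`. [folklore] -/
def cQ (d n : ℕ) (a : ℝ) : ℝ :=
  ((n : ℝ) + 1) ^ d * cStar d 1 (min 2 a) (c0 d n a) 1 * Real.exp (deltaStar d 1 (min 2 a) (c0 d n a) 1 * n)

/-- The (mesh-dependent) decay rate of `Q'G'Q'*` inherited from B4 (5.7) for `G'`. [folklore] -/
def deltaQ (d n : ℕ) (a : ℝ) : ℝ := deltaStar d 1 (min 2 a) (c0 d n a) 1

/-- `2γ₀ > 0`. [folklore] -/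
theorem gammaQ_pos (d : ℕ) {a : ℝ} (ha : 0 < a) : 0 < gammaQ d a := by unfold gammaQ; positivity

/-- `cQ > 0`. [folklore] -/
theorem cQ_pos (n : ℕ) {a : ℝ} (ha : 0 < a) : 0 < cQ d n a := by
  unfold cQ
  have := cStar_pos d 1 (c0 d n a) 1 (lt_min two_pos ha)
  positivity

/-- `deltaQ > 0`. [folklore] -/
theorem deltaQ_pos (n : ℕ) {a : ℝ} (ha : 0 < a) : 0 < deltaQ d n a :=
  deltaStar_pos d 1 (lt_min two_pos ha) (c0_pos d n ha.ne').le one_pos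

/-- **Entry bound for `Q'G'Q'*`**: `|(Q'G'Q'*)(y,y')| ≤ cQ·e^{−deltaQ·|y−y'|}` (from B4 (5.7) for `G'`,
`B4Sect5Exhaustion.limInv_abs_le`, summed over the two blocks). [folklore] -/
theorem abs_kerQGQ_le (n : ℕ) {a : ℝ} (ha : 0 < a) (y y' : X d) :
    |kerQGQ n a y y'| ≤ cQ d n a * Real.exp (-(deltaQ d n a * dist y y')) := by
  have hγ : 0 < min 2 a := lt_min two_pos ha
  have hc : 0 < c0 d n a := c0_pos d n ha.ne'
  have hδ : 0 < deltaQ d n a := deltaQ_pos n ha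
  have hsd : (0 : ℝ) < ((n : ℝ) + 1) ^ d := by positivity
  have hA := hyp56Z_Aker (d := d) n a
  have hC : 0 ≤ cStar d 1 (min 2 a) (c0 d n a) 1 := (cStar_pos d 1 (c0 d n a) 1 hγ).le
  have hterm : ∀ p ∈ B n y, ∀ q ∈ B n y', |limInv Set.univ (Aker n a) (p, 0) (q, 0)|
      ≤ cStar d 1 (min 2 a) (c0 d n a) 1 * Real.exp (deltaQ d n a * n) * Real.exp (-(deltaQ d n a * dist y y')) := by
    intro p hp q hq
    refine (limInv_abs_le hγ hc one_pos hA (p, 0) (q, 0)).trans ?_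
    have hd := dist_blk_le hp hq
    rw [mul_assoc, ← Real.exp_add]
    refine mul_le_mul_of_nonneg_left (Real.exp_le_exp.2 ?_) hC
    show -(deltaQ d n a * dist p q) ≤ deltaQ d n a * n + -(deltaQ d n a * dist y y')
    nlinarith
  unfold kerQGQ
  rw [abs_mul, abs_of_pos (by positivity : (0 : ℝ) < (((n : ℝ) + 1) ^ d)⁻¹)]
  calc (((n : ℝ) + 1) ^ d)⁻¹ * |∑ p ∈ B n y, ∑ q ∈ B n y', limInv Set.univ (Aker n a) (p, 0) (q, 0)|
      ≤ (((n : ℝ) + 1) ^ d)⁻¹ * ∑ _p ∈ B n y, ∑ _q ∈ B n y',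
          cStar d 1 (min 2 a) (c0 d n a) 1 * Real.exp (deltaQ d n a * n) * Real.exp (-(deltaQ d n a * dist y y')) := by
        refine mul_le_mul_of_nonneg_left ?_ (by positivity)
        refine (Finset.abs_sum_le_sum_abs _ _).trans (Finset.sum_le_sum fun p hp => ?_)
        exact (Finset.abs_sum_le_sum_abs _ _).trans (Finset.sum_le_sum fun q hq => hterm p hp q hq)
    _ = cQ d n a * Real.exp (-(deltaQ d n a * dist y y')) := by
        rw [sum_B_const, sum_B_const, ← mul_assoc, inv_mul_cancel₀ hsd.ne', one_mul]
        unfold cQ deltaQ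
        ring

/-- Coercivity of `Q'G'Q'*` on finitely supported vectors of `l²(ℤ^d)` (B4Sect5L2's `FinCoercive`), constant `2γ₀`.
[cite: Balaban1984PropagatorsII, (2.76) p.236] -/
theorem finCoercive_KerQGQ (n : ℕ) {a : ℝ} (ha : 0 < a) :
    FinCoercive (kerA (Set.univ : Set (Fin d → ℤ)) (KerQGQ (d := d) n a)) (gammaQ d a) := by
  classical
  intro s c
  have h := qGq_lower n ha (s.map embX) (fun x => c (ofX x))
  simp only [Finset.sum_map, embX_apply, ofX_toX] at h
  exact h

/-- **`Q'_jG'_jQ'_j*` satisfies condition (5.6) of B4 on `Ω = ℤ^d`**: symmetric, `≥ 2γ₀·I` on every finite `Λ`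
(uniformly in the mesh), exponentially decaying entries (mesh-dependent constants).  Consequently the whole B4
Sect. 5 machinery (`B4Sect5Exhaustion.sect5ThmSetOmega_holds`, `B4Sect5L2.sect5ThmL2_holds`) applies to
`A = Q'G'Q'*`: `(Q'G'Q'*)_Λ^{−1}` exists for every `Λ ⊆ ℤ^d` with kernels decaying at a rate `δ⋆(2γ₀, cQ, deltaQ)`.
[cite: Balaban1984PropagatorsII, (2.76) p.236] -/
theorem hyp56Z_KerQGQ (n : ℕ) {a : ℝ} (ha : 0 < a) :
    Hyp56Z (Set.univ : Set (Fin d → ℤ)) (KerQGQ (d := d) n a) (gammaQ d a) (cQ d n a) (deltaQ d n a) where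
  symm p q _ _ := kerQGQ_symm n ha p.1 q.1
  coercive Λ hΛ v := hyp56Z_coercive_of_finCoercive (finCoercive_KerQGQ n ha) Λ hΛ v
  decay p q _ _ := abs_kerQGQ_le n ha p.1 q.1

/-- **(2.76) as an operator inequality on `l²(ℤ^d)`**: `⟨f, Q'G'Q'* f⟩ ≥ 2γ₀‖f‖²` for every `f ∈ l²(ℤ^d)`.
[cite: Balaban1984PropagatorsII, (2.76) p.236] -/
theorem qGq_l2_lower (n : ℕ) {a : ℝ} (ha : 0 < a) (f : H (idx 1 (Set.univ : Set (Fin d → ℤ)))) :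
    gammaQ d a * ‖f‖ ^ 2
      ≤ inner ℝ (opA Set.univ (KerQGQ n a) (hyp56Z_KerQGQ n ha).decay (cQ_pos n ha).le (deltaQ_pos n ha) f) f :=
  inner_opA_self_ge (hyp56Z_KerQGQ n ha) (cQ_pos n ha).le (deltaQ_pos n ha) f

/-- **`(Q'_jG'_jQ'_j*)^{−1}` exists on `l²(ℤ^d)` with `‖(Q'G'Q'*)^{−1}‖ ≤ (2γ₀)^{−1} = 36^d(4d+a)`** — the input of
the propagator representations of B6 §2 built on `(Q'G'Q'*)^{−1}`. [cite: Balaban1984PropagatorsII, (2.76)–(2.77) p.236] -/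
theorem qGq_inverse (n : ℕ) {a : ℝ} (ha : 0 < a) :
    ∃ E : H (idx 1 (Set.univ : Set (Fin d → ℤ))) ≃L[ℝ] H (idx 1 (Set.univ : Set (Fin d → ℤ))),
      (∀ f, E f = opA Set.univ (KerQGQ n a) (hyp56Z_KerQGQ n ha).decay (cQ_pos n ha).le (deltaQ_pos n ha) f)
      ∧ ‖(E.symm : H (idx 1 (Set.univ : Set (Fin d → ℤ))) →L[ℝ] H (idx 1 (Set.univ : Set (Fin d → ℤ))))‖
          ≤ (gammaQ d a)⁻¹ :=
  ⟨opAEquiv (hyp56Z_KerQGQ n ha) (gammaQ_pos d ha) (cQ_pos n ha).le (deltaQ_pos n ha),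
    fun f => opAEquiv_apply _ _ _ _ f, norm_inv_le _ _ _ _⟩

/-- **B4 Sect. 5 Theorem for `A = Q'G'Q'*` on every `Λ ⊆ ℤ^d`** (exponential decay of `(Q'G'Q'*)_Λ^{−1}`, all `Λ`,
constants depending on `d, a` and the mesh only) — by `B4Sect5Exhaustion.sect5ThmSetOmega_holds` applied to
`hyp56Z_KerQGQ`. [cite: Balaban1984PropagatorsII, (2.76) p.236; Balaban1983RegularityDecay, Sect. 5 Theorem p.594] -/
theorem hyp56Z_KerQGQ_mono (n : ℕ) {a : ℝ} (ha : 0 < a) (Λ : Set (Fin d → ℤ)) :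
    Hyp56Z Λ (KerQGQ (d := d) n a) (gammaQ d a) (cQ d n a) (deltaQ d n a) :=
  (hyp56Z_KerQGQ n ha).mono (Set.subset_univ Λ)

end

end Literature.MathematicalPhysics.QuantumFieldTheory.Balaban1983to89.B6QGQLower276
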